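import Literature.MathematicalPhysics.QuantumFieldTheory.Balaban1983to89.Beta.BalabanStepJetsSucc

/-!
# The second-order background response through an arbitrary packed resolvent (β sub-cell, an2 lineage, (P4) carriers)

HONEST LABEL (cell charter): bookkeeping for the β-function audit of Bałaban's renormalization-group construction; «discharging
`BetaPertH` makes Balaban's UV stability UNCONDITIONAL — a real constructive-QFT result; it is NOT the continuum limit and NOT the Clay
problem».  This file is construction/bookkeeping only: NOT summit progress, NOT continuum, NOT Clay.

ABSOLUTE RULE (cell charter, verbatim): «No internally-minted statement may enter as a cited fact. Every hypothesis is either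
kernel-proved in this package or a verbatim quotation of a PUBLISHED theorem with page reference. The manuscript(s) under audit
are NOT citable for their own disputed steps — they are the thing under adjudication; programme-internal (2001/route/tribunal)
claims are never citable.»  Accordingly NO declaration below is a `def … : Prop` carrying a citation and no hypothesis of any
theorem is a located manuscript step: everything is [folklore] — definitions, or proved here from the imports.

WHAT THIS FILE IS FOR (work-order item (P4) of the β-lead, journal l.58019: «the second-order tables `W`»).  The wall statement
`OneStepKernelFamily.D1Drift Lc (BalabanStepJetsSucc.JsBalOf hLc cE cVH cΛ W Cw δw hδw hW) N μ ν` carries the second-order background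
family `W : ℕ → …` of every member as an HONEST BINDER (`VertexFamily₂ (W j) Lc (Cw j) (δw j)`).  This leaf supplies the GENERIC
CARRIER that builds such a family out of the fine tables of the bordered operator through an ARBITRARY packed resolvent `K` (so that the
step-`j` member reads it through an4's `KInvStep Lc j` exactly as `TstepOf` reads the first-order vertex through `vertexOfK`), together
with its localisation: `W2OfK K N S M S₂ M₂` and `vertexFamily₂_W2OfK` / `vertexFamily₂_W2OfK'` — the `(W, Cw, δw, hδw, hW)` binder
block of `JsBal0Of` for tables localised at positive rates.  The tables themselves (an3's `WilsonBiStencil.wilsonW₂` for the Wilson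
fourth jet, an1's second averaging jets and the mixed field–multiplier jet of the averaging Hessian, the value-function fourth jets for
`j ≥ 1`) and the colour weights are NOT here; they instantiate the four table slots in the successor leaf.

THE TYPED CONVENTION (located, informal — nothing of this paragraph is asserted in Lean).  Read off the column identities of the packed
one-shot resolvent (`KKTFluctuationKernel.Gam_EL`/`Gam_Q`, `KernelSpecInstance.wH_EL`/`colA_Q`): `OneStepResolventKernel.KInv` inverts
the bordered operator `𝕄(U, φ) = [[A″(U) − φ·Q″(U), −Q′(U)ᵀ], [Q′(U), 0]]` of the Lagrangian `A(U) − φ·(Q(U) − b)` (field rows =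
the Euler–Lagrange operator, multiplier rows = the constraint; `Gam`/`wH` = field response to a force / to a prescribed block average `b`,
`GamΦ`/`wΦ` = the multiplier's).  Along the constrained-minimiser family `b ↦ X(b) = (U(b), φ(b))` the first `b`-jets `X_b` are the
COLUMNS of `K = 𝕄⁻¹` — field rows = an4's `OneStepKernelFamily.colH K N μ y`, multiplier rows = `colM K N μ y` (§2) — and the second
`b`-jets `X_{bb′}` are the columns of `∂_{b′}K = −K (∂_{b′}𝕄) K` (`K2OfK`, §2; the shape and sign of `BalabanStepJetsSucc.e3Of`).  Hence
the second background jet of the operator, `∂_b∂_{b′}𝕄 = Σ X_b X_{b′} ∂²𝕄 + Σ X_{bb′} ∂𝕄`, is — with the PARTIAL-derivative tables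
`S κ u = ∂_{U_{(κ,u)}}𝕄` (the UNFOLDED first field stencil: the (V-Δ) and (V-H) pieces, no Lagrange piece), `M ρ w = ∂_{φ_{(ρ,w)}}𝕄 =
[[−Q″_{(ρ,w)}, 0], [0, 0]]`, `S₂ κ u κ′ u′ = ∂²_{UU}𝕄`, `M₂ κ u ρ w = ∂_U∂_φ𝕄 = [[−∂_{U_{(κ,u)}}Q″_{(ρ,w)}, 0], [0, 0]]`, and `∂²_{φφ}𝕄 = 0`
(the operator is affine in the multiplier) — exactly `W2OfK K N S M S₂ M₂ μ y ν y′` (§2).  WHY THE LAGRANGIAN CHART: the order-one fold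
`φ_b = c·U_b` behind the Lagrange piece `SLam` of `BalabanStepJets.S0` / `BalabanStepJetsSucc.Sstep` is exact at order one
(`dM K N S M = vertexOfK K N S^{fold}` informally) but FAILS at order two (`φ_{bb′} ≠ c·U_{bb′}`), so a folded second-order table would
need an extension-dependent `Λ″`; with explicit multiplier columns none is needed — the multiplier's second response is the multiplier
rows of `K2OfK`.  The relative weights and signs of the pieces (including the sign bookkeeping of the typed border, cf. `BalabanStepJets`'
header) belong to the weight pin, not to this file: the tables enter as parameters.

CONTENT.
* §1 BRICKS: `biLoc_cwsum_far` (the coarse-indexed version of `BalabanCompositeJets.biLoc_wsum_far`, via `InterLevelTransport.onLat`),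
  `biLoc_wsum_self_far` (weights decaying from `q`, kernels self-localised with constants decaying from `r` ⟹ bi-localised at `q`, rate
  `m/4`, constant `·e^{−(m/4)|q−r|}`), `biLoc_recenter_left` / `biLoc_recenter_right` (triangle inequality), `biLoc_neg`.
* §2 CARRIERS (generic: any packed `K : MKer (d+1) (Fib d)`, any blocking `N`, any `d`): `colM` + `abs_colM_le` + `colM_KInv`
  (`= wΦ ρ μ (w − y)`, `OneStepResolventKernel.KInv_inr_inr_coarse`), `abs_colH_le_of_biLoc` / `abs_colM_le_of_biLoc` (columns of a
  BI-LOCALISED kernel), `vertexOfM K N M μ y := Σ_ρ cwsum N (colM K N μ y ρ) (M ρ)`, `dM K N S M := vertexOfK K N S + vertexOfM K N M`,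
  `K2OfK K N S M ν y′ := −(K ∘ dM K N S M ν y′ ∘ K)`, `vertex2OfK K N S₂ μ y ν y′ := vertexOfK K N (fun κ u ↦ vertexOfK K N (S₂ κ u) ν y′)
  μ y` + `vertex2OfK_KInv` (`= BalabanCompositeJets.vertex2Of N S₂`, an4's `vertexOfK_KInv` twice), `mixOfK K N M₂ μ y ν y′ :=
  vertexOfK K N (fun κ u ↦ vertexOfM K N (M₂ κ u) ν y′) μ y`, and `W2OfK K N S M S₂ M₂ μ y ν y′ := vertex2OfK K N S₂ μ y ν y′ +
  mixOfK K N M₂ μ y ν y′ + mixOfK K N M₂ ν y′ μ y + dM (K2OfK K N S M ν y′) N S M μ y` (`W2OfK_apply`).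
* §3 LOCALISATION I: `vertexFamily_vertexOfM` (`InterLevelTransport.biLoc_cwsum` with `abs_colM_le` weights; rate `δ/2`),
  `vertexFamily_dM` (`+ OneStepKernelFamily.vertexFamily_vertexOfK`, `KernelWard.biLoc_add`), `biLoc_sandwich` (`−K∘V∘K`:
  `ExpKernelCalculus.biLoc_comp_decays` then `BalabanStepJetsSucc.biLoc_comp_right`; rate `m/4`), the constants `cdM`, `cK2` (+ `_nonneg`),
  `vertexFamily_K2OfK` (THE DERIVATIVE OF THE INVERSE IS A VERTEX FAMILY, rate `m/8`).
* §4 LOCALISATION II: `biLoc_vertexOfK_of_biLoc` / `biLoc_vertexOfM_of_biLoc` (chain-rule vertices through a BI-LOCALISED kernel: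
  `OneStepResolventKernel.biLoc_wsum` / `biLoc_cwsum` with the `_of_biLoc` column bounds), `vertexFamily₂_resp` (the second-response piece
  `dM (K2 ν y′) N S M μ y` for any vertex family `K2`, re-centred by `biLoc_recenter_left`; rate `m/2`), `biLoc_vertexOfK_slice` +
  `vertexFamily₂_vertex2OfK` (an4's-`vertexOfK` versions of BCJ's `biLoc_vertexOf_slice` / `vertexFamily₂_vertex2Of` with `abs_colH_le`
  weights; rate `m/8`, constant `cBi`), the table shape `LocStencilFM N M₂ C δ := ∀ κ u ρ w, BiLoc (M₂ κ u ρ w) u u (C·e^{−δ|u − N•w|}) δ`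
  (+ `.nonneg`, `.mono`), `biLoc_vertexOfM_slice` (`biLoc_cwsum_far`) + `vertexFamily₂_mixOfK` (rate `m/8`, constant `cBi`),
  `vertexFamily₂_mixOfK_swap` (the exchanged mixed term in the index order of `W`: `biLoc_wsum_self_far` + `biLoc_recenter_left`), the
  constant `CW2`, **`vertexFamily₂_W2OfK`** (`VertexFamily₂ (W2OfK K N S M S₂ M₂) N (CW2 d C Cs CM C₂ CM₂ m) (m/16)` from `Decays K C m`,
  `LocStencil S Cs m`, `VertexFamily M N CM m`, `LocStencil₂ S₂ C₂ m`, `LocStencilFM N M₂ CM₂ m`) and the packaged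
  **`vertexFamily₂_W2OfK'`** (`∃ Cw δw, 0 < δw ∧ VertexFamily₂ (W2OfK K N S M S₂ M₂) N Cw δw` from SOME decay of `K` and SOME positive rates of
  the four tables — for the step-`j` member: `K := KInvStep Lc j` with `OneStepKernelFamily.decays_KInvStep j`).
* §5 (v1.1) COVARIANCE — the (Wt) SOCKET OF THE CARRIER (work-order (R31-1); the byte shape `W j μ (y + t) ν (y′ + t) = shiftK (−Lc•t)
  (W j μ y ν y′)` of `BalabanStepJetsSucc.JsBalOf_W_translate`): two-family shift bricks `wsum_shift₂` / `cwsum_translate₂`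
  (`OneStepResolventKernel.wsum_shift` / `InterLevelTransport.cwsum_translate` with the shifted family allowed to differ from the original —
  needed because a second table is covariant only under the JOINT shift of its two indices), `colH_shiftK` / `colM_shiftK` (columns of a
  SHIFTED kernel, no invariance needed), `vertexOfK_shiftK_translate₂` / `vertexOfM_shiftK_translate₂`, `dM_shiftK_translate` /
  `dM_translate`, `K2OfK_translate` (`ExpKernelCalculus.comp_shiftK`, as in `BalabanStepJetsSucc.comp_sandwich_shiftK`),
  `vertex2OfK_translate` (JOINTLY block-covariant `S₂`: `S₂ κ (u + N•t) κ′ (u′ + N•t) = shiftK (−N•t) (S₂ κ u κ′ u′)`), `mixOfK_translate`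
  (jointly covariant `M₂ κ (u + N•t) ρ (w + t) = shiftK (−N•t) (M₂ κ u ρ w)`), **`W2OfK_translate`** (from `shiftK (−N•t) K = K` — an4's
  `shiftK_KInvStep` for the step member —, block covariance of `S` (the (St♭) shape of `BalabanStepJetsSucc` §8), coarse covariance of `M`,
  joint covariance of `S₂`, `M₂`).
* §6 (v1.1) THE SWAP-SYMMETRISED CARRIER (β-lead binder item (w1), journal pre-rotation l.≈59649: «SYMMETRY in (μy)↔(νy′) stated, or the
  symmetrised table used»): `W2SymOfK := ½•(W2OfK μ y ν y′ + W2OfK ν y′ μ y)`, `W2SymOfK_swap` (symmetric by construction),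
  `W2SymOfK_eq_of_swap` (equal to `W2OfK` whenever `W2OfK` is swap-symmetric — the case of genuine partial-derivative tables, NOT asserted
  here), `biLoc_smul`, the exchanged-order localisations `vertexFamily₂_vertex2OfK_swap` / `vertexFamily₂_resp_swap` (second leg re-centred,
  `biLoc_recenter_right`) / `vertexFamily₂_W2OfK_swap`, **`vertexFamily₂_W2SymOfK`** (same constant `CW2`, same rate `m/16`) + packaged
  `vertexFamily₂_W2SymOfK'`, and its (Wt) socket `W2SymOfK_translate`.
WHAT IS NOT HERE: (a) the tables — `S₂`'s field block for `j = 0` is an3's `WilsonBiStencil.wilsonW₂` (whose `biLoc_wilsonW₂` has the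
`LocStencil₂` shape), its border blocks are an1's second averaging jets (node 12, in progress), `M₂` is an1's mixed jet (requested, journal
X-an2-37), the `j ≥ 1` field blocks are the value-function fourth jets (successor leaf, with `Sc (j−1)` as in `e3Of`); (b) the family
instantiation `W j := W2SymOfK (KInvStep Lc j) Lc …` (or `W2OfK`) inside `JsBal0Of` and the colour weights ((P6), after (P6′)); (c) the
REFLECTION covariance sockets (Sr)/(Wr) of the carrier ((R31-1); with an5's `refK`/`bref`/`reflSign` by name, successor version) — the
translation socket (Wt) IS here since v1.1 (§5); (d) any identification of `W2OfK` with a finite-volume second derivative, and the swap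
symmetry of `W2OfK` itself for genuine partial-derivative tables (Schwarz) — the CONVENTION paragraph is prose, §6 offers the symmetrised
carrier instead; (e) NOT continuum; NOT Clay.

Provenance: β sub-cell an2 lineage, gen 10 (2026-08-19); v1 (§1–§4), v1.1 (+§5 covariance, +§6 symmetrised carrier; additive — every v1
declaration unchanged); over `Beta.BalabanStepJetsSucc` v1.1 (`biLoc_comp_right`), `Beta.BalabanCompositeJets`
v1.5 (`LocStencil₂`, `vertex2Of`, `biLoc_wsum_far`, `biLoc_wsum_two`), `Beta.OneStepKernelFamily` (an4: `colH`, `abs_colH_le`, `vertexOfK`,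
`vertexOfK_KInv`, `vertexFamily_vertexOfK`), `Beta.OneStepResolventKernel` (`wsum`, `biLoc_wsum`, `KInv`), `Beta.InterLevelTransport`
(`onLat`, `cwsum`, `biLoc_cwsum`), `Beta.ExpKernelCalculus` (`biLoc_comp_decays`, `shiftK`, `comp_shiftK`), `Beta.KernelWard` (`biLoc_add`),
`Beta.KKTFluctuationEnergy` (`tsum_shift`), `LatticeForm.proj_add_zsmul`, `BlochFibreUniqueness.quo_add_zsmul` — all BY NAME; nothing
restated (the two-family shift bricks of §5 GENERALISE `wsum_shift` / `cwsum_translate`, which are their `G = K` instances, and are labelled so).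
-/

noncomputable section

open Finset
open scoped BigOperators
open Literature.MathematicalPhysics.QuantumFieldTheory
open Literature.MathematicalPhysics.QuantumFieldTheory.Balaban1983to89
open Literature.MathematicalPhysics.QuantumFieldTheory.Balaban1983to89.Beta
open Literature.Probability.LatticeModels (Torus.proj)
open LatticeForm (quo proj_add_zsmul)
open BlochFibreUniqueness (quo_add_zsmul)
open KKTFluctuationEnergy (tsum_shift)
open B12Sec2to5 (l1 l1_nonneg)
open ExpKernelCalculus (MKer Decays BiLoc VertexFamily VertexFamily₂ comp shiftK comp_shiftK Zl Zl_nonneg l1_sub_triangle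
  l1_sub_symm summable_exp_shift' tsum_exp_shift' biLoc_comp_decays)
open OneStepResolventKernel (Fib LocStencil KInv wsum biLoc_wsum eq_zsmul_quo_of_proj bound_mono decays_mono biLoc_mono vertexOf)
open OneStepKernelFamily (colH abs_colH_le vertexOfK vertexOfK_KInv vertexFamily_vertexOfK)
open InterLevelTransport (onLat onLat_off cwsum biLoc_cwsum)
open BalabanStepJets (locStencil_mono vertexFamily₂_mono)
open BalabanCompositeJets (LocStencil₂ vertex2Of biLoc_wsum_far biLoc_wsum_two)
open BalabanStepJetsSucc (biLoc_comp_right)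
open KernelSpecInstance (wΦ)

namespace Literature.MathematicalPhysics.QuantumFieldTheory.Balaban1983to89.Beta.SecondOrderResponse

variable {d : ℕ}

/-! ## §1 Three localisation bricks: coarse far-centred superpositions, self-localised kernels with far-decaying constants,
## re-centring -/

section Bricks

variable {N : ℕ}

/-- [folklore] **COARSE-INDEXED WEIGHTED SUM, FAR CENTRE** (the coarse version of `BalabanCompositeJets.biLoc_wsum_far`): weights indexed
by the coarse points, decaying (fine units, rate `m`) from `q`; kernels all bi-localised at a FIXED `p` with constants decaying in the
distance of their coarse point from `p` ⟹ the superposition `cwsum N w Q` is bi-localised at `p` with a constant decaying in `|p − q|`. -/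
theorem biLoc_cwsum_far [NeZero N] {w : (Fin (d + 1) → ℤ) → ℝ} {Q : (Fin (d + 1) → ℤ) → MKer (d + 1) (Fib d)}
    {Cw Ck m δ' : ℝ} {p q : Fin (d + 1) → ℤ} (hw : ∀ y, |w y| ≤ Cw * Real.exp (-m * l1 ((N : ℤ) • y - q)))
    (hQ : ∀ y, BiLoc (Q y) p p (Ck * Real.exp (-m * l1 ((N : ℤ) • y - p))) δ') (hm : 0 < m) (hCw : 0 ≤ Cw) (hCk : 0 ≤ Ck) :
    BiLoc (cwsum N w Q) p p (Cw * Ck * Zl (d + 1) (m / 2) * Real.exp (-(m / 2) * l1 (p - q))) δ' := by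
  unfold cwsum
  refine biLoc_wsum_far (fun v => ?_) (fun v => ?_) hm hCw hCk
  · by_cases hv : Torus.proj N v = 0
    · have e := eq_zsmul_quo_of_proj (N := N) hv
      simp only [onLat, hv, if_true]
      have h := hw (quo N v)
      rwa [← e] at h
    · rw [onLat_off w hv, abs_zero]
      positivity
  · by_cases hv : Torus.proj N v = 0
    · have e := eq_zsmul_quo_of_proj (N := N) hv
      simp only [onLat, hv, if_true]
      have h := hQ (quo N v)
      rwa [← e] at h
    · intro x z a b
      rw [onLat_off Q hv]
      show |(0 : ℝ)| ≤ _
      rw [abs_zero]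
      positivity

/-- [folklore] **WEIGHTED SUM OF SELF-LOCALISED KERNELS WITH FAR-DECAYING CONSTANTS**: weights decaying from `q`, kernels bi-localised at
their own index with constants decaying in the distance of the index from a third point `r` ⟹ the sum is bi-localised at `q` (a quarter
of the rate) with a constant decaying in `|q − r|`. -/
theorem biLoc_wsum_self_far {w : (Fin (d + 1) → ℤ) → ℝ} {K : (Fin (d + 1) → ℤ) → MKer (d + 1) (Fib d)} {Cw Ck m : ℝ}
    {q r : Fin (d + 1) → ℤ} (hw : ∀ u, |w u| ≤ Cw * Real.exp (-m * l1 (u - q)))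
    (hK : ∀ u, BiLoc (K u) u u (Ck * Real.exp (-m * l1 (u - r))) m) (hm : 0 < m) (hCw : 0 ≤ Cw) (hCk : 0 ≤ Ck) :
    BiLoc (wsum w K) q q (Cw * Ck * Zl (d + 1) (m / 4) * Real.exp (-(m / 4) * l1 (q - r))) (m / 4) := by
  intro x z a b
  show |∑' u, w u * K u x z a b| ≤ _
  have hm4 : 0 < m / 4 := by positivity
  have hs := (summable_exp_shift' hm4 q).mul_left
    (Cw * Ck * Real.exp (-(m / 4) * l1 (q - r)) * Real.exp (-(m / 4) * (l1 (x - q) + l1 (z - q))))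
  have hb := tsum_of_norm_bounded hs.hasSum (fun u => by
    rw [Real.norm_eq_abs, abs_mul]
    have h1 := hw u
    have h2 := hK u x z a b
    have hexp : Real.exp (-m * l1 (u - q)) * (Real.exp (-m * l1 (u - r)) * Real.exp (-m * (l1 (x - u) + l1 (z - u))))
        ≤ Real.exp (-(m / 4) * l1 (q - r)) * Real.exp (-(m / 4) * (l1 (x - q) + l1 (z - q)))
          * Real.exp (-(m / 4) * l1 (u - q)) := by
      rw [← Real.exp_add, ← Real.exp_add, ← Real.exp_add, ← Real.exp_add, Real.exp_le_exp]
      have t0 : l1 (q - r) ≤ l1 (q - u) + l1 (u - r) := l1_sub_triangle q u r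
      have t1 : l1 (x - q) ≤ l1 (x - u) + l1 (u - q) := l1_sub_triangle x u q
      have t2 : l1 (z - q) ≤ l1 (z - u) + l1 (u - q) := l1_sub_triangle z u q
      have s0 : l1 (q - u) = l1 (u - q) := l1_sub_symm q u
      have n1 := l1_nonneg (x - u)
      have n2 := l1_nonneg (z - u)
      have n3 := l1_nonneg (u - q)
      have n4 := l1_nonneg (u - r)
      nlinarith [mul_nonneg hm.le (show 0 ≤ l1 (q - u) + l1 (u - r) - l1 (q - r) by linarith),
        mul_nonneg hm.le (show 0 ≤ l1 (x - u) + l1 (u - q) - l1 (x - q) by linarith),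
        mul_nonneg hm.le (show 0 ≤ l1 (z - u) + l1 (u - q) - l1 (z - q) by linarith),
        mul_nonneg hm.le n1, mul_nonneg hm.le n2, mul_nonneg hm.le n3, mul_nonneg hm.le n4]
    calc |w u| * |K u x z a b|
        ≤ (Cw * Real.exp (-m * l1 (u - q)))
            * (Ck * Real.exp (-m * l1 (u - r)) * Real.exp (-m * (l1 (x - u) + l1 (z - u)))) :=
          mul_le_mul h1 h2 (abs_nonneg _) (by positivity)
      _ = Cw * Ck * (Real.exp (-m * l1 (u - q))
            * (Real.exp (-m * l1 (u - r)) * Real.exp (-m * (l1 (x - u) + l1 (z - u))))) := by ring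
      _ ≤ Cw * Ck * (Real.exp (-(m / 4) * l1 (q - r)) * Real.exp (-(m / 4) * (l1 (x - q) + l1 (z - q)))
            * Real.exp (-(m / 4) * l1 (u - q))) := mul_le_mul_of_nonneg_left hexp (by positivity)
      _ = _ := by ring)
  rw [Real.norm_eq_abs] at hb
  refine hb.trans (le_of_eq ?_)
  rw [tsum_mul_left, tsum_exp_shift']
  ring

variable {D : ℕ} {F : Type*}

/-- [folklore] **RE-CENTRING THE FIRST LEG**: a kernel bi-localised at `(p, q)` with a constant decaying (at least at the same rate) in
`|p′ − p|` is bi-localised at `(p′, q)` (triangle inequality). -/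
theorem biLoc_recenter_left {K : MKer D F} {p p' q : Fin D → ℤ} {C δ δ' : ℝ}
    (h : BiLoc K p q (C * Real.exp (-δ' * l1 (p' - p))) δ) (hC : 0 ≤ C) (hδ : 0 ≤ δ) (hδ' : δ ≤ δ') : BiLoc K p' q C δ := by
  intro x z a b
  refine (h x z a b).trans ?_
  rw [mul_assoc, ← Real.exp_add]
  refine mul_le_mul_of_nonneg_left (Real.exp_le_exp.2 ?_) hC
  have t : l1 (x - p') ≤ l1 (x - p) + l1 (p - p') := l1_sub_triangle x p p'
  have s : l1 (p - p') = l1 (p' - p) := l1_sub_symm p p'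
  have e1 := mul_le_mul_of_nonneg_left t hδ
  have e2 := mul_le_mul_of_nonneg_right hδ' (l1_nonneg (p' - p))
  rw [s] at e1
  nlinarith [e1, e2]

/-- [folklore] **RE-CENTRING THE SECOND LEG** (same, for the second slot). -/
theorem biLoc_recenter_right {K : MKer D F} {p q q' : Fin D → ℤ} {C δ δ' : ℝ}
    (h : BiLoc K p q (C * Real.exp (-δ' * l1 (q' - q))) δ) (hC : 0 ≤ C) (hδ : 0 ≤ δ) (hδ' : δ ≤ δ') : BiLoc K p q' C δ := by
  intro x z a b
  refine (h x z a b).trans ?_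
  rw [mul_assoc, ← Real.exp_add]
  refine mul_le_mul_of_nonneg_left (Real.exp_le_exp.2 ?_) hC
  have t : l1 (z - q') ≤ l1 (z - q) + l1 (q - q') := l1_sub_triangle z q q'
  have s : l1 (q - q') = l1 (q' - q) := l1_sub_symm q q'
  have e1 := mul_le_mul_of_nonneg_left t hδ
  have e2 := mul_le_mul_of_nonneg_right hδ' (l1_nonneg (q' - q))
  rw [s] at e1
  nlinarith [e1, e2]

/-- [folklore] Bi-localisation of the pointwise negative. -/
theorem biLoc_neg {K : MKer D F} {p q : Fin D → ℤ} {C δ : ℝ} (h : BiLoc K p q C δ) :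
    BiLoc (fun x z a b => -(K x z a b)) p q C δ := by
  intro x z a b
  rw [abs_neg]
  exact h x z a b

end Bricks

/-! ## §2 The carriers: multiplier columns, the multiplier-column vertex, the operator derivative `dM`, the derivative of the inverse
## `K2OfK`, the bi-vertex, the mixed bi-vertex, and the second-order family `W2OfK` -/

section Carriers

variable {N : ℕ}

/-- [folklore] **THE MULTIPLIER COLUMN** of a packed kernel at the coarse bond `(μ, y)`: `ρ, w ↦ K (N•w) (N•y) (inr ρ) (inr μ)` — the
multiplier rows of the `(μ, y)`-column (for `K = KInv N`: `wΦ ρ μ (w − y)`, `colM_KInv`), i.e. the linear response of the constraint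
multiplier at the coarse bond `(ρ, w)` to the prescribed average at `(μ, y)`; the companion of an4's field rows `OneStepKernelFamily.colH`. -/
def colM (K : MKer (d + 1) (Fib d)) (N : ℕ) (μ : Fin (d + 1)) (y : Fin (d + 1) → ℤ) (ρ : Fin (d + 1)) (w : Fin (d + 1) → ℤ) : ℝ :=
  K ((N : ℤ) • w) ((N : ℤ) • y) (Sum.inr ρ) (Sum.inr μ)

/-- [folklore] The multiplier column of a decaying kernel decays (fine units) from the coarse point. -/
theorem abs_colM_le {K : MKer (d + 1) (Fib d)} {C δ : ℝ} (hK : Decays K C δ) (μ : Fin (d + 1)) (y : Fin (d + 1) → ℤ)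
    (ρ : Fin (d + 1)) (w : Fin (d + 1) → ℤ) : |colM K N μ y ρ w| ≤ C * Real.exp (-δ * l1 ((N : ℤ) • w - (N : ℤ) • y)) :=
  hK _ _ _ _

/-- [folklore] For the one-shot resolvent the multiplier column is the multiplier-response kernel `wΦ` of `KernelSpecInstance`. -/
theorem colM_KInv [NeZero N] (μ : Fin (d + 1)) (y : Fin (d + 1) → ℤ) (ρ : Fin (d + 1)) (w : Fin (d + 1) → ℤ) :
    colM (KInv (N := N)) N μ y ρ w = wΦ (N := N) ρ μ (w - y) :=
  OneStepResolventKernel.KInv_inr_inr_coarse (N := N) ρ μ w y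

/-- [folklore] The field rows of the `(μ, y)`-column of a kernel BI-LOCALISED at `(q, q)` decay from `q`, with a constant decaying in
`|N•y − q|`. -/
theorem abs_colH_le_of_biLoc {K : MKer (d + 1) (Fib d)} {q : Fin (d + 1) → ℤ} {C m : ℝ} (h : BiLoc K q q C m)
    (μ : Fin (d + 1)) (y : Fin (d + 1) → ℤ) (κ : Fin (d + 1)) (u : Fin (d + 1) → ℤ) :
    |colH K N μ y κ u| ≤ C * Real.exp (-m * l1 ((N : ℤ) • y - q)) * Real.exp (-m * l1 (u - q)) := by
  have h1 := h u ((N : ℤ) • y) (Sum.inl κ) (Sum.inr μ)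
  rw [mul_add, Real.exp_add] at h1
  calc |colH K N μ y κ u| = |K u ((N : ℤ) • y) (Sum.inl κ) (Sum.inr μ)| := rfl
    _ ≤ _ := h1
    _ = _ := by ring

/-- [folklore] The multiplier rows of the `(μ, y)`-column of a kernel bi-localised at `(q, q)` decay from `q`, with a constant decaying
in `|N•y − q|`. -/
theorem abs_colM_le_of_biLoc {K : MKer (d + 1) (Fib d)} {q : Fin (d + 1) → ℤ} {C m : ℝ} (h : BiLoc K q q C m)
    (μ : Fin (d + 1)) (y : Fin (d + 1) → ℤ) (ρ : Fin (d + 1)) (w : Fin (d + 1) → ℤ) :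
    |colM K N μ y ρ w| ≤ C * Real.exp (-m * l1 ((N : ℤ) • y - q)) * Real.exp (-m * l1 ((N : ℤ) • w - q)) := by
  have h1 := h ((N : ℤ) • w) ((N : ℤ) • y) (Sum.inr ρ) (Sum.inr μ)
  rw [mul_add, Real.exp_add] at h1
  calc |colM K N μ y ρ w| = |K ((N : ℤ) • w) ((N : ℤ) • y) (Sum.inr ρ) (Sum.inr μ)| := rfl
    _ ≤ _ := h1
    _ = _ := by ring

/-- [folklore] **THE MULTIPLIER-COLUMN VERTEX** `vertexOfM K N M μ y := Σ_ρ Σ'_w K (N•w) (N•y) (inr ρ) (inr μ) • M ρ w`: the first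
`B`-jet at the coarse bond `(μ, y)` of an operator depending on the background through the MULTIPLIER (table `M ρ w` = the partial
derivative in the multiplier component `(ρ, w)`, a kernel localised at the coarse bond), when the multiplier's linear response is the
multiplier column of `K` — the companion of an4's `vertexOfK` (field rows), written with the coarse-indexed superposition
`InterLevelTransport.cwsum`. -/
def vertexOfM (K : MKer (d + 1) (Fib d)) (N : ℕ) (M : Fin (d + 1) → (Fin (d + 1) → ℤ) → MKer (d + 1) (Fib d)) (μ : Fin (d + 1))
    (y : Fin (d + 1) → ℤ) : MKer (d + 1) (Fib d) :=
  fun x z a b => ∑ ρ : Fin (d + 1), cwsum N (colM K N μ y ρ) (M ρ) x z a b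

/-- [folklore] **THE BACKGROUND DERIVATIVE OF THE OPERATOR** along the bond `(μ, y)` in the Lagrangian (field + multiplier) chart:
`dM K N S M μ y := vertexOfK K N S μ y + vertexOfM K N M μ y` — field partials `S κ u` weighted by the field rows of the `(μ, y)`-column
of `K`, multiplier partials `M ρ w` weighted by its multiplier rows. -/
def dM (K : MKer (d + 1) (Fib d)) (N : ℕ) (S : Fin (d + 1) → (Fin (d + 1) → ℤ) → MKer (d + 1) (Fib d))
    (M : Fin (d + 1) → (Fin (d + 1) → ℤ) → MKer (d + 1) (Fib d)) (μ : Fin (d + 1)) (y : Fin (d + 1) → ℤ) : MKer (d + 1) (Fib d) :=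
  vertexOfK K N S μ y + vertexOfM K N M μ y

/-- [folklore] **THE BACKGROUND DERIVATIVE OF THE INVERSE** along the bond `(ν, y′)`: `K2OfK K N S M ν y′ := −K ∘ (dM K N S M ν y′) ∘ K`
(`∂(𝕄⁻¹) = −𝕄⁻¹ (∂𝕄) 𝕄⁻¹`; the same shape and sign as `BalabanStepJetsSucc.e3Of`). Its columns are the SECOND background jets of the
minimiser and of the multiplier. -/
def K2OfK (K : MKer (d + 1) (Fib d)) (N : ℕ) (S : Fin (d + 1) → (Fin (d + 1) → ℤ) → MKer (d + 1) (Fib d))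
    (M : Fin (d + 1) → (Fin (d + 1) → ℤ) → MKer (d + 1) (Fib d)) (ν : Fin (d + 1)) (y' : Fin (d + 1) → ℤ) : MKer (d + 1) (Fib d) :=
  fun x z a b => -(comp (comp K (dM K N S M ν y')) K x z a b)

/-- [folklore] **THE BI-VERTEX THROUGH AN ARBITRARY PACKED RESOLVENT**: both fine bond slots of a bi-stencil family `S₂ κ u κ′ u′` (the
second field partials) read through the field rows of the columns of `K` at the two coarse bonds —
`vertex2OfK K N S₂ μ y ν y′ := vertexOfK K N (fun κ u ↦ vertexOfK K N (S₂ κ u) ν y′) μ y`. -/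
def vertex2OfK (K : MKer (d + 1) (Fib d)) (N : ℕ)
    (S₂ : Fin (d + 1) → (Fin (d + 1) → ℤ) → Fin (d + 1) → (Fin (d + 1) → ℤ) → MKer (d + 1) (Fib d))
    (μ : Fin (d + 1)) (y : Fin (d + 1) → ℤ) (ν : Fin (d + 1)) (y' : Fin (d + 1) → ℤ) : MKer (d + 1) (Fib d) :=
  vertexOfK K N (fun κ u => vertexOfK K N (S₂ κ u) ν y') μ y

/-- [folklore] For the one-shot resolvent the bi-vertex is the one of `BalabanCompositeJets` (`vertexOfK_KInv` twice). -/
theorem vertex2OfK_KInv [NeZero N]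
    (S₂ : Fin (d + 1) → (Fin (d + 1) → ℤ) → Fin (d + 1) → (Fin (d + 1) → ℤ) → MKer (d + 1) (Fib d))
    (μ : Fin (d + 1)) (y : Fin (d + 1) → ℤ) (ν : Fin (d + 1)) (y' : Fin (d + 1) → ℤ) :
    vertex2OfK (KInv (N := N)) N S₂ μ y ν y' = vertex2Of N S₂ μ y ν y' := by
  unfold vertex2OfK vertex2Of
  have h : (fun κ u => vertexOfK (KInv (N := N)) N (S₂ κ u) ν y') = fun κ u => vertexOf (N := N) (S₂ κ u) ν y' := by
    funext κ u
    exact vertexOfK_KInv (N := N) (S₂ κ u) ν y'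
  rw [h]
  exact vertexOfK_KInv (N := N) _ μ y

/-- [folklore] **THE MIXED BI-VERTEX**: a field–multiplier table `M₂ κ u ρ w` (the mixed second partials `∂_{U_{(κ,u)}} ∂_{φ_{(ρ,w)}}`) with
the field slot read through the field rows of the `(μ, y)`-column of `K` and the multiplier slot through the multiplier rows of the
`(ν, y′)`-column — `mixOfK K N M₂ μ y ν y′ := vertexOfK K N (fun κ u ↦ vertexOfM K N (M₂ κ u) ν y′) μ y`; the term with the two columns
exchanged is `mixOfK K N M₂ ν y′ μ y`. -/
def mixOfK (K : MKer (d + 1) (Fib d)) (N : ℕ)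
    (M₂ : Fin (d + 1) → (Fin (d + 1) → ℤ) → Fin (d + 1) → (Fin (d + 1) → ℤ) → MKer (d + 1) (Fib d))
    (μ : Fin (d + 1)) (y : Fin (d + 1) → ℤ) (ν : Fin (d + 1)) (y' : Fin (d + 1) → ℤ) : MKer (d + 1) (Fib d) :=
  vertexOfK K N (fun κ u => vertexOfM K N (M₂ κ u) ν y') μ y

/-- [folklore] **THE SECOND-ORDER BACKGROUND FAMILY THROUGH AN ARBITRARY PACKED RESOLVENT** (the Lagrangian-chart chain rule at order two
along the minimiser family `b ↦ (U(b), φ(b))` of a bordered operator `𝕄(U, φ)` with `K = 𝕄⁻¹` at the base point):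
`∂_b ∂_{b′} 𝕄 = Σ X_b X_{b′} ∂²𝕄 + Σ X_{bb′} ∂𝕄` with `X_b` the columns of `K` and `X_{bb′}` the columns of `K2OfK … b′`, i.e.
`W2OfK K N S M S₂ M₂ μ y ν y′ := vertex2OfK K N S₂ μ y ν y′ + mixOfK K N M₂ μ y ν y′ + mixOfK K N M₂ ν y′ μ y
+ dM (K2OfK K N S M ν y′) N S M μ y` — tables: `S` = first field partials, `M` = first multiplier partials, `S₂` = second field partials,
`M₂` = mixed partials (the multiplier–multiplier second partials of a bordered operator affine in the multiplier vanish). -/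
def W2OfK (K : MKer (d + 1) (Fib d)) (N : ℕ) (S : Fin (d + 1) → (Fin (d + 1) → ℤ) → MKer (d + 1) (Fib d))
    (M : Fin (d + 1) → (Fin (d + 1) → ℤ) → MKer (d + 1) (Fib d))
    (S₂ : Fin (d + 1) → (Fin (d + 1) → ℤ) → Fin (d + 1) → (Fin (d + 1) → ℤ) → MKer (d + 1) (Fib d))
    (M₂ : Fin (d + 1) → (Fin (d + 1) → ℤ) → Fin (d + 1) → (Fin (d + 1) → ℤ) → MKer (d + 1) (Fib d))
    (μ : Fin (d + 1)) (y : Fin (d + 1) → ℤ) (ν : Fin (d + 1)) (y' : Fin (d + 1) → ℤ) : MKer (d + 1) (Fib d) :=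
  vertex2OfK K N S₂ μ y ν y' + mixOfK K N M₂ μ y ν y' + mixOfK K N M₂ ν y' μ y + dM (K2OfK K N S M ν y') N S M μ y

/-- [folklore] The four pieces of `W2OfK`, by `rfl`. -/
theorem W2OfK_apply (K : MKer (d + 1) (Fib d)) (N : ℕ) (S : Fin (d + 1) → (Fin (d + 1) → ℤ) → MKer (d + 1) (Fib d))
    (M : Fin (d + 1) → (Fin (d + 1) → ℤ) → MKer (d + 1) (Fib d))
    (S₂ : Fin (d + 1) → (Fin (d + 1) → ℤ) → Fin (d + 1) → (Fin (d + 1) → ℤ) → MKer (d + 1) (Fib d))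
    (M₂ : Fin (d + 1) → (Fin (d + 1) → ℤ) → Fin (d + 1) → (Fin (d + 1) → ℤ) → MKer (d + 1) (Fib d))
    (μ : Fin (d + 1)) (y : Fin (d + 1) → ℤ) (ν : Fin (d + 1)) (y' : Fin (d + 1) → ℤ) :
    W2OfK K N S M S₂ M₂ μ y ν y'
      = vertex2OfK K N S₂ μ y ν y' + mixOfK K N M₂ μ y ν y' + mixOfK K N M₂ ν y' μ y + dM (K2OfK K N S M ν y') N S M μ y :=
  rfl

/-- [folklore] `dM` read pointwise. -/
theorem dM_apply (K : MKer (d + 1) (Fib d)) (N : ℕ) (S : Fin (d + 1) → (Fin (d + 1) → ℤ) → MKer (d + 1) (Fib d))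
    (M : Fin (d + 1) → (Fin (d + 1) → ℤ) → MKer (d + 1) (Fib d)) (μ : Fin (d + 1)) (y : Fin (d + 1) → ℤ)
    (x z : Fin (d + 1) → ℤ) (a b : Fib d) :
    dM K N S M μ y x z a b = vertexOfK K N S μ y x z a b + vertexOfM K N M μ y x z a b :=
  rfl

end Carriers

/-! ## §3 Localisation I: the multiplier-column vertex, `dM`, and the derivative of the inverse are vertex families -/

section LocFirst

variable {N : ℕ} [NeZero N]

/-- [folklore] **THE MULTIPLIER-COLUMN VERTEX IS A VERTEX FAMILY** for any decaying `K` and any table localised at the coarse bonds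
(`VertexFamily M N C_M δ`, rate `δ ≤` the decay rate of `K`): rate `δ/2`, constant `(d+1)·C·C_M·Zl(δ/2)`. -/
theorem vertexFamily_vertexOfM {K : MKer (d + 1) (Fib d)} {C δK : ℝ} (hK : Decays K C δK) (hC : 0 ≤ C)
    {M : Fin (d + 1) → (Fin (d + 1) → ℤ) → MKer (d + 1) (Fib d)} {CM δ : ℝ} (hM : VertexFamily M N CM δ) (hδ : 0 < δ)
    (hδK : δ ≤ δK) : VertexFamily (vertexOfM K N M) N ((d + 1 : ℕ) * (C * CM * Zl (d + 1) (δ / 2))) (δ / 2) := by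
  intro μ y
  have hterm : ∀ ρ : Fin (d + 1), BiLoc (cwsum N (colM K N μ y ρ) (M ρ)) ((N : ℤ) • y) ((N : ℤ) • y)
      (C * CM * Zl (d + 1) (δ / 2)) (δ / 2) := by
    intro ρ
    refine biLoc_cwsum (fun w => ?_) (fun w => hM ρ w) hδ hC
    exact bound_mono (abs_colM_le (N := N) hK μ y ρ w) hC le_rfl hδK (l1_nonneg _)
  have hsum := OneStepResolventKernel.biLoc_finset_sum (Finset.univ : Finset (Fin (d + 1))) (fun ρ _ => hterm ρ)
  simp only [Finset.sum_const, Finset.card_univ, Fintype.card_fin, nsmul_eq_mul] at hsum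
  exact hsum

/-- [folklore] **`dM` IS A VERTEX FAMILY** (sum of the two chain-rule vertices; constants add). -/
theorem vertexFamily_dM {K : MKer (d + 1) (Fib d)} {C δK : ℝ} (hK : Decays K C δK) (hC : 0 ≤ C)
    {S : Fin (d + 1) → (Fin (d + 1) → ℤ) → MKer (d + 1) (Fib d)} {Cs : ℝ}
    {M : Fin (d + 1) → (Fin (d + 1) → ℤ) → MKer (d + 1) (Fib d)} {CM δ : ℝ} (hS : LocStencil S Cs δ) (hM : VertexFamily M N CM δ)
    (hδ : 0 < δ) (hδK : δ ≤ δK) :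
    VertexFamily (dM K N S M) N ((d + 1 : ℕ) * (C * Cs * Zl (d + 1) (δ / 2)) + (d + 1 : ℕ) * (C * CM * Zl (d + 1) (δ / 2)))
      (δ / 2) := by
  intro μ y
  exact KernelWard.biLoc_add (vertexFamily_vertexOfK (N := N) hK hC hS hδ hδK μ y) (vertexFamily_vertexOfM hK hC hM hδ hδK μ y)

/-- [folklore] **SANDWICH**: `−K ∘ V ∘ K` of a kernel `V` bi-localised at `(p, q)` (rate `m`) between two copies of a kernel decaying at
rate `m` is bi-localised at `(p, q)` at rate `m/4` (`ExpKernelCalculus.biLoc_comp_decays`, then `BalabanStepJetsSucc.biLoc_comp_right`). -/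
theorem biLoc_sandwich {K V : MKer (d + 1) (Fib d)} {C CV m : ℝ} {p q : Fin (d + 1) → ℤ} (hK : Decays K C m) (hC : 0 ≤ C)
    (hm : 0 < m) (hV : BiLoc V p q CV m) :
    BiLoc (fun x z a b => -(comp (comp K V) K x z a b)) p q
      ((Fintype.card (Fib d) : ℝ) * ((Fintype.card (Fib d) : ℝ) * (C * CV) * Zl (d + 1) (m / 2) * C) * Zl (d + 1) (m / 4))
      (m / 4) := by
  have h1 : BiLoc (comp K V) p q ((Fintype.card (Fib d) : ℝ) * (C * CV) * Zl (d + 1) (m - m / 2)) (m / 2) :=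
    biLoc_comp_decays hK hV (by positivity) (by linarith)
  rw [show m - m / 2 = m / 2 by ring] at h1
  have hK2 : Decays K C (m / 2) := decays_mono hK hC le_rfl (by linarith)
  have h2 := biLoc_comp_right h1 hK2 (show (0 : ℝ) ≤ m / 4 by positivity) (by linarith)
  rw [show m / 2 - m / 4 = m / 4 by ring] at h2
  exact biLoc_neg h2

/-- [folklore] The constant of `vertexFamily_dM` as a function of the input constants (rate `m` in, `m/2` out). -/
def cdM (d : ℕ) (C Cs CM m : ℝ) : ℝ :=
  (d + 1 : ℕ) * (C * Cs * Zl (d + 1) (m / 2)) + (d + 1 : ℕ) * (C * CM * Zl (d + 1) (m / 2))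

/-- [folklore] The constant of `vertexFamily_K2OfK` (rate `m` in, `m/8` out). -/
def cK2 (d : ℕ) (C Cs CM m : ℝ) : ℝ :=
  (Fintype.card (Fib d) : ℝ) * ((Fintype.card (Fib d) : ℝ) * (C * cdM d C Cs CM m) * Zl (d + 1) (m / 4) * C) * Zl (d + 1) (m / 8)

/-- [folklore] **THE DERIVATIVE OF THE INVERSE IS A VERTEX FAMILY**: for `K` decaying at rate `m` and first tables localised at rate `m`,
`K2OfK K N S M` is bi-localised at the coarse bond at rate `m/8` (constant `cK2`). -/
theorem vertexFamily_K2OfK {K : MKer (d + 1) (Fib d)} {C m : ℝ} (hK : Decays K C m) (hC : 0 ≤ C) (hm : 0 < m)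
    {S : Fin (d + 1) → (Fin (d + 1) → ℤ) → MKer (d + 1) (Fib d)} {Cs : ℝ}
    {M : Fin (d + 1) → (Fin (d + 1) → ℤ) → MKer (d + 1) (Fib d)} {CM : ℝ} (hS : LocStencil S Cs m) (hM : VertexFamily M N CM m) :
    VertexFamily (K2OfK K N S M) N (cK2 d C Cs CM m) (m / 8) := by
  intro ν y'
  have hV := vertexFamily_dM hK hC hS hM hm le_rfl ν y'
  have hK2 : Decays K C (m / 2) := decays_mono hK hC le_rfl (by linarith)
  have h := biLoc_sandwich hK2 hC (half_pos hm) hV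
  rw [show m / 2 / 2 = m / 4 by ring, show m / 2 / 4 = m / 8 by ring] at h
  exact h

/-- [folklore] The constant `cdM` is nonnegative for nonnegative inputs. -/
theorem cdM_nonneg {C Cs CM m : ℝ} (hC : 0 ≤ C) (hCs : 0 ≤ Cs) (hCM : 0 ≤ CM) (hm : 0 < m) : 0 ≤ cdM d C Cs CM m := by
  unfold cdM
  have := Zl_nonneg (D := d + 1) (half_pos hm)
  positivity

/-- [folklore] The constant `cK2` is nonnegative for nonnegative inputs. -/
theorem cK2_nonneg {C Cs CM m : ℝ} (hC : 0 ≤ C) (hCs : 0 ≤ Cs) (hCM : 0 ≤ CM) (hm : 0 < m) : 0 ≤ cK2 d C Cs CM m := by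
  unfold cK2
  have h1 := cdM_nonneg (d := d) hC hCs hCM hm
  have h2 := Zl_nonneg (D := d + 1) (show 0 < m / 4 by positivity)
  have h3 := Zl_nonneg (D := d + 1) (show 0 < m / 8 by positivity)
  positivity

end LocFirst

/-! ## §4 Localisation II: the second-response piece, the bi-vertex, the mixed bi-vertices, and the assembled family -/

section LocSecond

variable {N : ℕ} [NeZero N]

omit [NeZero N] in
/-- [folklore] The field-column vertex through a kernel BI-LOCALISED at `(q, q)` (rate `m`) of a local stencil family (rate `m`) is
bi-localised at `(q, q)` (rate `m/2`) with a constant decaying in `|N•y − q|`. -/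
theorem biLoc_vertexOfK_of_biLoc {K₂ : MKer (d + 1) (Fib d)} {q : Fin (d + 1) → ℤ} {C₂ m : ℝ} (hK₂ : BiLoc K₂ q q C₂ m)
    {S : Fin (d + 1) → (Fin (d + 1) → ℤ) → MKer (d + 1) (Fib d)} {Cs : ℝ} (hS : LocStencil S Cs m) (hm : 0 < m)
    (μ : Fin (d + 1)) (y : Fin (d + 1) → ℤ) :
    BiLoc (vertexOfK K₂ N S μ y) q q
      ((d + 1 : ℕ) * (C₂ * Real.exp (-m * l1 ((N : ℤ) • y - q)) * Cs * Zl (d + 1) (m / 2))) (m / 2) := by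
  have hC₂e : 0 ≤ C₂ * Real.exp (-m * l1 ((N : ℤ) • y - q)) := mul_nonneg (hK₂.nonneg (Sum.inl 0)) (Real.exp_pos _).le
  have hterm : ∀ κ : Fin (d + 1), BiLoc (wsum (colH K₂ N μ y κ) (S κ)) q q
      (C₂ * Real.exp (-m * l1 ((N : ℤ) • y - q)) * Cs * Zl (d + 1) (m / 2)) (m / 2) := fun κ =>
    biLoc_wsum (fun u => abs_colH_le_of_biLoc (N := N) hK₂ μ y κ u) (fun u => hS κ u) hm hC₂e
  have hsum := OneStepResolventKernel.biLoc_finset_sum (Finset.univ : Finset (Fin (d + 1))) (fun κ _ => hterm κ)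
  simp only [Finset.sum_const, Finset.card_univ, Fintype.card_fin, nsmul_eq_mul] at hsum
  exact hsum

/-- [folklore] The multiplier-column vertex through a kernel bi-localised at `(q, q)` of a coarse-localised table is bi-localised at
`(q, q)` (rate `m/2`) with a constant decaying in `|N•y − q|`. -/
theorem biLoc_vertexOfM_of_biLoc {K₂ : MKer (d + 1) (Fib d)} {q : Fin (d + 1) → ℤ} {C₂ m : ℝ} (hK₂ : BiLoc K₂ q q C₂ m)
    {M : Fin (d + 1) → (Fin (d + 1) → ℤ) → MKer (d + 1) (Fib d)} {CM : ℝ} (hM : VertexFamily M N CM m) (hm : 0 < m)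
    (μ : Fin (d + 1)) (y : Fin (d + 1) → ℤ) :
    BiLoc (vertexOfM K₂ N M μ y) q q
      ((d + 1 : ℕ) * (C₂ * Real.exp (-m * l1 ((N : ℤ) • y - q)) * CM * Zl (d + 1) (m / 2))) (m / 2) := by
  have hC₂e : 0 ≤ C₂ * Real.exp (-m * l1 ((N : ℤ) • y - q)) := mul_nonneg (hK₂.nonneg (Sum.inl 0)) (Real.exp_pos _).le
  have hterm : ∀ ρ : Fin (d + 1), BiLoc (cwsum N (colM K₂ N μ y ρ) (M ρ)) q q
      (C₂ * Real.exp (-m * l1 ((N : ℤ) • y - q)) * CM * Zl (d + 1) (m / 2)) (m / 2) := fun ρ =>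
    biLoc_cwsum (fun w => abs_colM_le_of_biLoc (N := N) hK₂ μ y ρ w) (fun w => hM ρ w) hm hC₂e
  have hsum := OneStepResolventKernel.biLoc_finset_sum (Finset.univ : Finset (Fin (d + 1))) (fun ρ _ => hterm ρ)
  simp only [Finset.sum_const, Finset.card_univ, Fintype.card_fin, nsmul_eq_mul] at hsum
  exact hsum

/-- [folklore] **THE SECOND-RESPONSE PIECE IS A BI-LOCALISED VERTEX FAMILY**: for any vertex family `K2 ν y′` of kernels (rate `m`) in the
role of the derivative of the inverse, `(μ, y, ν, y′) ↦ dM (K2 ν y′) N S M μ y` is a `VertexFamily₂` at rate `m/2` (both chain-rule vertices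
are bi-localised at `N•y′` with constants decaying in `|N•y − N•y′|`, `biLoc_vertexOfK_of_biLoc` / `biLoc_vertexOfM_of_biLoc`; the first leg
is re-centred to `N•y` by `biLoc_recenter_left`). -/
theorem vertexFamily₂_resp {K2 : Fin (d + 1) → (Fin (d + 1) → ℤ) → MKer (d + 1) (Fib d)} {C₂ m : ℝ} (hK2 : VertexFamily K2 N C₂ m)
    {S : Fin (d + 1) → (Fin (d + 1) → ℤ) → MKer (d + 1) (Fib d)} {Cs : ℝ}
    {M : Fin (d + 1) → (Fin (d + 1) → ℤ) → MKer (d + 1) (Fib d)} {CM : ℝ} (hS : LocStencil S Cs m) (hM : VertexFamily M N CM m)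
    (hm : 0 < m) :
    VertexFamily₂ (fun μ y ν y' => dM (K2 ν y') N S M μ y) N
      ((d + 1 : ℕ) * (C₂ * Cs * Zl (d + 1) (m / 2)) + (d + 1 : ℕ) * (C₂ * CM * Zl (d + 1) (m / 2))) (m / 2) := by
  intro μ y ν y'
  have h := KernelWard.biLoc_add (biLoc_vertexOfK_of_biLoc (N := N) (hK2 ν y') hS hm μ y)
    (biLoc_vertexOfM_of_biLoc (N := N) (hK2 ν y') hM hm μ y)
  have e : (d + 1 : ℕ) * (C₂ * Real.exp (-m * l1 ((N : ℤ) • y - (N : ℤ) • y')) * Cs * Zl (d + 1) (m / 2))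
      + (d + 1 : ℕ) * (C₂ * Real.exp (-m * l1 ((N : ℤ) • y - (N : ℤ) • y')) * CM * Zl (d + 1) (m / 2))
      = ((d + 1 : ℕ) * (C₂ * Cs * Zl (d + 1) (m / 2)) + (d + 1 : ℕ) * (C₂ * CM * Zl (d + 1) (m / 2)))
        * Real.exp (-m * l1 ((N : ℤ) • y - (N : ℤ) • y')) := by ring
  rw [e] at h
  have hC₂ : 0 ≤ C₂ := (hK2 0 0).nonneg (Sum.inl 0)
  have hCs : 0 ≤ Cs := (hS 0 0).nonneg (Sum.inl 0)
  have hCM : 0 ≤ CM := (hM 0 0).nonneg (Sum.inl 0)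
  have hZ := Zl_nonneg (D := d + 1) (half_pos hm)
  exact biLoc_recenter_left h (by positivity) (half_pos hm).le (by linarith)

omit [NeZero N] in
/-- [folklore] **THE INNER FIELD-COLUMN VERTEX OF A SLICE IS A FAR-CENTRED STENCIL** (an4's `vertexOfK` version of
`BalabanCompositeJets.biLoc_vertexOf_slice`): for a local bi-stencil family at rate `m` and a kernel decaying at rate `m`,
`vertexOfK K N (S₂ κ u) ν y′` is bi-localised at the first bond `u` with constant `(d+1)·C·C₂·Zl(m/2)·e^{−(m/2)|u − N•y′|}`. -/
theorem biLoc_vertexOfK_slice {K : MKer (d + 1) (Fib d)} {C m : ℝ} (hK : Decays K C m) (hC : 0 ≤ C)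
    {S₂ : Fin (d + 1) → (Fin (d + 1) → ℤ) → Fin (d + 1) → (Fin (d + 1) → ℤ) → MKer (d + 1) (Fib d)} {C₂ : ℝ}
    (hS₂ : LocStencil₂ S₂ C₂ m) (hm : 0 < m) (κ : Fin (d + 1)) (u : Fin (d + 1) → ℤ) (ν : Fin (d + 1)) (y' : Fin (d + 1) → ℤ) :
    BiLoc (vertexOfK K N (S₂ κ u) ν y') u u
      ((d + 1 : ℕ) * (C * C₂ * Zl (d + 1) (m / 2) * Real.exp (-(m / 2) * l1 (u - (N : ℤ) • y')))) m := by
  have hC₂ := hS₂.nonneg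
  have hterm : ∀ κ' : Fin (d + 1), BiLoc (wsum (colH K N ν y' κ') (S₂ κ u κ'))
      u u (C * C₂ * Zl (d + 1) (m / 2) * Real.exp (-(m / 2) * l1 (u - (N : ℤ) • y'))) m := fun κ' =>
    biLoc_wsum_far (fun u' => abs_colH_le (N := N) hK ν y' κ' u') (fun u' => hS₂ κ u κ' u') hm hC hC₂
  have hsum := OneStepResolventKernel.biLoc_finset_sum (Finset.univ : Finset (Fin (d + 1))) (fun κ' _ => hterm κ')
  simp only [Finset.sum_const, Finset.card_univ, Fintype.card_fin, nsmul_eq_mul] at hsum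
  exact hsum

/-- [folklore] The constant of the bi-vertex localisations (`vertexFamily₂_vertex2OfK`, `vertexFamily₂_mixOfK`,
`vertexFamily₂_mixOfK_swap`; rate `m` in, `m/8` out). -/
def cBi (d : ℕ) (C C₂ m : ℝ) : ℝ :=
  (d + 1 : ℕ) * (C * ((d + 1 : ℕ) * (C * C₂ * Zl (d + 1) (m / 2))) * Zl (d + 1) (m / 8))

/-- [folklore] The constant `cBi` is nonnegative for nonnegative inputs. -/
theorem cBi_nonneg {C C₂ m : ℝ} (hC : 0 ≤ C) (hC₂ : 0 ≤ C₂) (hm : 0 < m) : 0 ≤ cBi d C C₂ m := by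
  unfold cBi
  have h2 := Zl_nonneg (D := d + 1) (half_pos hm)
  have h3 := Zl_nonneg (D := d + 1) (show 0 < m / 8 by positivity)
  positivity

omit [NeZero N] in
/-- [folklore] **LOCALISATION OF THE BI-VERTEX** (the `vertexOfK` version of `BalabanCompositeJets.vertexFamily₂_vertex2Of`): for a kernel
decaying at rate `m` and a local bi-stencil family at rate `m`, `vertex2OfK K N S₂` is a `VertexFamily₂` at rate `m/8`. -/
theorem vertexFamily₂_vertex2OfK {K : MKer (d + 1) (Fib d)} {C m : ℝ} (hK : Decays K C m) (hC : 0 ≤ C)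
    {S₂ : Fin (d + 1) → (Fin (d + 1) → ℤ) → Fin (d + 1) → (Fin (d + 1) → ℤ) → MKer (d + 1) (Fib d)} {C₂ : ℝ}
    (hS₂ : LocStencil₂ S₂ C₂ m) (hm : 0 < m) : VertexFamily₂ (vertex2OfK K N S₂) N (cBi d C C₂ m) (m / 8) := by
  intro μ y ν y'
  have hC₂ := hS₂.nonneg
  have hZ2 := Zl_nonneg (D := d + 1) (half_pos hm)
  have hK₁ : 0 ≤ (d + 1 : ℕ) * (C * C₂ * Zl (d + 1) (m / 2)) := by positivity
  have hin : ∀ (κ : Fin (d + 1)) (u : Fin (d + 1) → ℤ), BiLoc (vertexOfK K N (S₂ κ u) ν y') u u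
      ((d + 1 : ℕ) * (C * C₂ * Zl (d + 1) (m / 2)) * Real.exp (-(m / 2) * l1 (u - (N : ℤ) • y'))) (m / 2) := by
    intro κ u
    have h := biLoc_vertexOfK_slice (N := N) hK hC hS₂ hm κ u ν y'
    rw [← mul_assoc] at h
    exact biLoc_mono h (by positivity) (by linarith)
  have hw : ∀ (κ : Fin (d + 1)) (u : Fin (d + 1) → ℤ),
      |colH K N μ y κ u| ≤ C * Real.exp (-(m / 2) * l1 (u - (N : ℤ) • y)) :=
    fun κ u => bound_mono (abs_colH_le (N := N) hK μ y κ u) hC le_rfl (by linarith) (l1_nonneg _)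
  have hterm : ∀ κ : Fin (d + 1), BiLoc (wsum (colH K N μ y κ) (fun u => vertexOfK K N (S₂ κ u) ν y'))
      ((N : ℤ) • y) ((N : ℤ) • y') (C * ((d + 1 : ℕ) * (C * C₂ * Zl (d + 1) (m / 2))) * Zl (d + 1) (m / 2 / 4)) (m / 2 / 4) :=
    fun κ => biLoc_wsum_two (hw κ) (hin κ) (half_pos hm) hC hK₁
  have hsum := OneStepResolventKernel.biLoc_finset_sum (Finset.univ : Finset (Fin (d + 1))) (fun κ _ => hterm κ)
  simp only [Finset.sum_const, Finset.card_univ, Fintype.card_fin, nsmul_eq_mul] at hsum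
  rw [show m / 2 / 4 = m / 8 by ring] at hsum
  exact hsum

/-- [folklore] **LOCAL FIELD–MULTIPLIER TABLE** `M₂ κ u ρ w` (a kernel per (fine bond, coarse bond) pair — the shape of a mixed second
partial `∂_{U_{(κ,u)}} ∂_{φ_{(ρ,w)}}` of a bordered operator, e.g. one background leg on the fluctuation–fluctuation averaging Hessian at the
coarse bond `(ρ, w)`): bi-localised at the fine bond `u` with a constant decaying in the distance of `u` from the coarse point `N•w`. -/
def LocStencilFM (N : ℕ) (M₂ : Fin (d + 1) → (Fin (d + 1) → ℤ) → Fin (d + 1) → (Fin (d + 1) → ℤ) → MKer (d + 1) (Fib d))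
    (C δ : ℝ) : Prop :=
  ∀ κ u ρ w, BiLoc (M₂ κ u ρ w) u u (C * Real.exp (-δ * l1 (u - (N : ℤ) • w))) δ

omit [NeZero N] in
/-- [folklore] The constant of a `LocStencilFM` bound is nonnegative. -/
theorem LocStencilFM.nonneg {M₂ : Fin (d + 1) → (Fin (d + 1) → ℤ) → Fin (d + 1) → (Fin (d + 1) → ℤ) → MKer (d + 1) (Fib d)}
    {C δ : ℝ} (h : LocStencilFM N M₂ C δ) : 0 ≤ C := by
  have h1 : 0 ≤ C * Real.exp (-δ * l1 ((0 : Fin (d + 1) → ℤ) - (N : ℤ) • (0 : Fin (d + 1) → ℤ))) :=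
    (h 0 0 0 0).nonneg (Sum.inl 0)
  rw [smul_zero, sub_zero, BalabanCompositeJets.l1_zero', mul_zero, Real.exp_zero, mul_one] at h1
  exact h1

omit [NeZero N] in
/-- [folklore] A `LocStencilFM` bound weakens to a smaller rate. -/
theorem LocStencilFM.mono {M₂ : Fin (d + 1) → (Fin (d + 1) → ℤ) → Fin (d + 1) → (Fin (d + 1) → ℤ) → MKer (d + 1) (Fib d)}
    {C δ : ℝ} (h : LocStencilFM N M₂ C δ) {m : ℝ} (hm : m ≤ δ) : LocStencilFM N M₂ C m := by
  have hC := h.nonneg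
  intro κ u ρ w
  have h1 : BiLoc (M₂ κ u ρ w) u u (C * Real.exp (-m * l1 (u - (N : ℤ) • w))) δ := by
    intro x z a b
    refine (h κ u ρ w x z a b).trans (mul_le_mul_of_nonneg_right ?_ (Real.exp_pos _).le)
    exact mul_le_mul_of_nonneg_left (Real.exp_le_exp.2 (by nlinarith [l1_nonneg (u - (N : ℤ) • w)])) hC
  exact biLoc_mono h1 (by positivity) hm

/-- [folklore] **THE INNER MULTIPLIER-COLUMN VERTEX OF A MIXED SLICE IS A FAR-CENTRED STENCIL**: for a local field–multiplier table at rate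
`m` and a kernel decaying at rate `m`, `vertexOfM K N (M₂ κ u) ν y′` is bi-localised at the fine bond `u` with constant
`(d+1)·C·C₂·Zl(m/2)·e^{−(m/2)|u − N•y′|}` (`biLoc_cwsum_far`). -/
theorem biLoc_vertexOfM_slice {K : MKer (d + 1) (Fib d)} {C m : ℝ} (hK : Decays K C m) (hC : 0 ≤ C)
    {M₂ : Fin (d + 1) → (Fin (d + 1) → ℤ) → Fin (d + 1) → (Fin (d + 1) → ℤ) → MKer (d + 1) (Fib d)} {C₂ : ℝ}
    (hM₂ : LocStencilFM N M₂ C₂ m) (hm : 0 < m) (κ : Fin (d + 1)) (u : Fin (d + 1) → ℤ) (ν : Fin (d + 1))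
    (y' : Fin (d + 1) → ℤ) :
    BiLoc (vertexOfM K N (M₂ κ u) ν y') u u
      ((d + 1 : ℕ) * (C * C₂ * Zl (d + 1) (m / 2) * Real.exp (-(m / 2) * l1 (u - (N : ℤ) • y')))) m := by
  have hC₂ := hM₂.nonneg
  have hQ : ∀ (ρ : Fin (d + 1)) (w : Fin (d + 1) → ℤ),
      BiLoc (M₂ κ u ρ w) u u (C₂ * Real.exp (-m * l1 ((N : ℤ) • w - u))) m := by
    intro ρ w
    have h := hM₂ κ u ρ w
    rwa [l1_sub_symm] at h
  have hterm : ∀ ρ : Fin (d + 1), BiLoc (cwsum N (colM K N ν y' ρ) (M₂ κ u ρ))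
      u u (C * C₂ * Zl (d + 1) (m / 2) * Real.exp (-(m / 2) * l1 (u - (N : ℤ) • y'))) m := fun ρ =>
    biLoc_cwsum_far (fun w => abs_colM_le (N := N) hK ν y' ρ w) (fun w => hQ ρ w) hm hC hC₂
  have hsum := OneStepResolventKernel.biLoc_finset_sum (Finset.univ : Finset (Fin (d + 1))) (fun ρ _ => hterm ρ)
  simp only [Finset.sum_const, Finset.card_univ, Fintype.card_fin, nsmul_eq_mul] at hsum
  exact hsum

/-- [folklore] **LOCALISATION OF THE MIXED BI-VERTEX** (field column at the first bond, multiplier column at the second): rate `m/8`,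
constant `cBi`. -/
theorem vertexFamily₂_mixOfK {K : MKer (d + 1) (Fib d)} {C m : ℝ} (hK : Decays K C m) (hC : 0 ≤ C)
    {M₂ : Fin (d + 1) → (Fin (d + 1) → ℤ) → Fin (d + 1) → (Fin (d + 1) → ℤ) → MKer (d + 1) (Fib d)} {C₂ : ℝ}
    (hM₂ : LocStencilFM N M₂ C₂ m) (hm : 0 < m) : VertexFamily₂ (mixOfK K N M₂) N (cBi d C C₂ m) (m / 8) := by
  intro μ y ν y'
  have hC₂ := hM₂.nonneg
  have hZ2 := Zl_nonneg (D := d + 1) (half_pos hm)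
  have hK₁ : 0 ≤ (d + 1 : ℕ) * (C * C₂ * Zl (d + 1) (m / 2)) := by positivity
  have hin : ∀ (κ : Fin (d + 1)) (u : Fin (d + 1) → ℤ), BiLoc (vertexOfM K N (M₂ κ u) ν y') u u
      ((d + 1 : ℕ) * (C * C₂ * Zl (d + 1) (m / 2)) * Real.exp (-(m / 2) * l1 (u - (N : ℤ) • y'))) (m / 2) := by
    intro κ u
    have h := biLoc_vertexOfM_slice (N := N) hK hC hM₂ hm κ u ν y'
    rw [← mul_assoc] at h
    exact biLoc_mono h (by positivity) (by linarith)
  have hw : ∀ (κ : Fin (d + 1)) (u : Fin (d + 1) → ℤ),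
      |colH K N μ y κ u| ≤ C * Real.exp (-(m / 2) * l1 (u - (N : ℤ) • y)) :=
    fun κ u => bound_mono (abs_colH_le (N := N) hK μ y κ u) hC le_rfl (by linarith) (l1_nonneg _)
  have hterm : ∀ κ : Fin (d + 1), BiLoc (wsum (colH K N μ y κ) (fun u => vertexOfM K N (M₂ κ u) ν y'))
      ((N : ℤ) • y) ((N : ℤ) • y') (C * ((d + 1 : ℕ) * (C * C₂ * Zl (d + 1) (m / 2))) * Zl (d + 1) (m / 2 / 4)) (m / 2 / 4) :=
    fun κ => biLoc_wsum_two (hw κ) (hin κ) (half_pos hm) hC hK₁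
  have hsum := OneStepResolventKernel.biLoc_finset_sum (Finset.univ : Finset (Fin (d + 1))) (fun κ _ => hterm κ)
  simp only [Finset.sum_const, Finset.card_univ, Fintype.card_fin, nsmul_eq_mul] at hsum
  rw [show m / 2 / 4 = m / 8 by ring] at hsum
  exact hsum

/-- [folklore] **LOCALISATION OF THE EXCHANGED MIXED BI-VERTEX** (field column at the SECOND bond, multiplier column at the first):
`(μ, y, ν, y′) ↦ mixOfK K N M₂ ν y′ μ y` is a `VertexFamily₂` in the index order of `W` — all legs are mutually close, so the kernel is
bi-localised at `N•y′` with a constant decaying in `|N•y − N•y′|` (`biLoc_wsum_self_far`) and the first leg is re-centred to `N•y`. -/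
theorem vertexFamily₂_mixOfK_swap {K : MKer (d + 1) (Fib d)} {C m : ℝ} (hK : Decays K C m) (hC : 0 ≤ C)
    {M₂ : Fin (d + 1) → (Fin (d + 1) → ℤ) → Fin (d + 1) → (Fin (d + 1) → ℤ) → MKer (d + 1) (Fib d)} {C₂ : ℝ}
    (hM₂ : LocStencilFM N M₂ C₂ m) (hm : 0 < m) :
    VertexFamily₂ (fun μ y ν y' => mixOfK K N M₂ ν y' μ y) N (cBi d C C₂ m) (m / 8) := by
  intro μ y ν y'
  have hC₂ := hM₂.nonneg
  have hZ2 := Zl_nonneg (D := d + 1) (half_pos hm)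
  have hK₁ : 0 ≤ (d + 1 : ℕ) * (C * C₂ * Zl (d + 1) (m / 2)) := by positivity
  have hin : ∀ (κ : Fin (d + 1)) (u : Fin (d + 1) → ℤ), BiLoc (vertexOfM K N (M₂ κ u) μ y) u u
      ((d + 1 : ℕ) * (C * C₂ * Zl (d + 1) (m / 2)) * Real.exp (-(m / 2) * l1 (u - (N : ℤ) • y))) (m / 2) := by
    intro κ u
    have h := biLoc_vertexOfM_slice (N := N) hK hC hM₂ hm κ u μ y
    rw [← mul_assoc] at h
    exact biLoc_mono h (by positivity) (by linarith)
  have hw : ∀ (κ : Fin (d + 1)) (u : Fin (d + 1) → ℤ),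
      |colH K N ν y' κ u| ≤ C * Real.exp (-(m / 2) * l1 (u - (N : ℤ) • y')) :=
    fun κ u => bound_mono (abs_colH_le (N := N) hK ν y' κ u) hC le_rfl (by linarith) (l1_nonneg _)
  have hterm : ∀ κ : Fin (d + 1), BiLoc (wsum (colH K N ν y' κ) (fun u => vertexOfM K N (M₂ κ u) μ y))
      ((N : ℤ) • y') ((N : ℤ) • y') (C * ((d + 1 : ℕ) * (C * C₂ * Zl (d + 1) (m / 2))) * Zl (d + 1) (m / 2 / 4)
        * Real.exp (-(m / 2 / 4) * l1 ((N : ℤ) • y' - (N : ℤ) • y))) (m / 2 / 4) :=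
    fun κ => biLoc_wsum_self_far (hw κ) (hin κ) (half_pos hm) hC hK₁
  have hsum := OneStepResolventKernel.biLoc_finset_sum (Finset.univ : Finset (Fin (d + 1))) (fun κ _ => hterm κ)
  simp only [Finset.sum_const, Finset.card_univ, Fintype.card_fin, nsmul_eq_mul] at hsum
  rw [show m / 2 / 4 = m / 8 by ring, l1_sub_symm ((N : ℤ) • y') ((N : ℤ) • y)] at hsum
  have e : (d + 1 : ℕ) * (C * ((d + 1 : ℕ) * (C * C₂ * Zl (d + 1) (m / 2))) * Zl (d + 1) (m / 8)
      * Real.exp (-(m / 8) * l1 ((N : ℤ) • y - (N : ℤ) • y')))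
      = cBi d C C₂ m * Real.exp (-(m / 8) * l1 ((N : ℤ) • y - (N : ℤ) • y')) := by unfold cBi; ring
  rw [e] at hsum
  exact biLoc_recenter_left hsum (cBi_nonneg hC hC₂ hm) (by positivity) le_rfl

/-- [folklore] The constant of `vertexFamily₂_W2OfK` (rate `m` in, `m/16` out): three bi-vertex constants and the second-response constant
through `cK2`. -/
def CW2 (d : ℕ) (C Cs CM C₂ CM₂ m : ℝ) : ℝ :=
  cBi d C C₂ m + cBi d C CM₂ m + cBi d C CM₂ m
    + ((d + 1 : ℕ) * (cK2 d C Cs CM m * Cs * Zl (d + 1) (m / 8 / 2)) + (d + 1 : ℕ) * (cK2 d C Cs CM m * CM * Zl (d + 1) (m / 8 / 2)))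

/-- [folklore] **THE SECOND-ORDER BACKGROUND FAMILY IS A BI-LOCALISED VERTEX FAMILY**: for a packed kernel `K` decaying at rate `m` and
tables `S` (`LocStencil`), `M` (`VertexFamily`), `S₂` (`LocStencil₂`), `M₂` (`LocStencilFM`) all localised at rate `m`,
`W2OfK K N S M S₂ M₂` satisfies `VertexFamily₂ … N (CW2 …) (m/16)` — exactly the `(W, Cw, δw, hδw, hW)` binder block of
`BalabanStepJetsSucc.JsBal0Of` / `BalabanStepJets.jsBal0Of`. -/
theorem vertexFamily₂_W2OfK {K : MKer (d + 1) (Fib d)} {C m : ℝ} (hK : Decays K C m) (hC : 0 ≤ C) (hm : 0 < m)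
    {S : Fin (d + 1) → (Fin (d + 1) → ℤ) → MKer (d + 1) (Fib d)} {Cs : ℝ}
    {M : Fin (d + 1) → (Fin (d + 1) → ℤ) → MKer (d + 1) (Fib d)} {CM : ℝ}
    {S₂ : Fin (d + 1) → (Fin (d + 1) → ℤ) → Fin (d + 1) → (Fin (d + 1) → ℤ) → MKer (d + 1) (Fib d)} {C₂ : ℝ}
    {M₂ : Fin (d + 1) → (Fin (d + 1) → ℤ) → Fin (d + 1) → (Fin (d + 1) → ℤ) → MKer (d + 1) (Fib d)} {CM₂ : ℝ}
    (hS : LocStencil S Cs m) (hM : VertexFamily M N CM m) (hS₂ : LocStencil₂ S₂ C₂ m) (hM₂ : LocStencilFM N M₂ CM₂ m) :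
    VertexFamily₂ (W2OfK K N S M S₂ M₂) N (CW2 d C Cs CM C₂ CM₂ m) (m / 16) := by
  have hCs : 0 ≤ Cs := (hS 0 0).nonneg (Sum.inl 0)
  have hCM : 0 ≤ CM := (hM 0 0).nonneg (Sum.inl 0)
  have hC₂ := hS₂.nonneg
  have hCM₂ := hM₂.nonneg
  have h16 : m / 16 ≤ m / 8 := by linarith
  -- the three bi-vertex pieces at rate `m/8`, weakened to `m/16`
  have h1 : VertexFamily₂ (vertex2OfK K N S₂) N (cBi d C C₂ m) (m / 16) :=
    vertexFamily₂_mono (vertexFamily₂_vertex2OfK (N := N) hK hC hS₂ hm) (cBi_nonneg hC hC₂ hm) h16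
  have h2 : VertexFamily₂ (mixOfK K N M₂) N (cBi d C CM₂ m) (m / 16) :=
    vertexFamily₂_mono (vertexFamily₂_mixOfK (N := N) hK hC hM₂ hm) (cBi_nonneg hC hCM₂ hm) h16
  have h3 : VertexFamily₂ (fun μ y ν y' => mixOfK K N M₂ ν y' μ y) N (cBi d C CM₂ m) (m / 16) :=
    vertexFamily₂_mono (vertexFamily₂_mixOfK_swap (N := N) hK hC hM₂ hm) (cBi_nonneg hC hCM₂ hm) h16
  -- the second-response piece: `K2OfK` is a vertex family at rate `m/8`; the first tables weakened to `m/8`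
  have hK2 := vertexFamily_K2OfK (N := N) hK hC hm hS hM
  have hm8 : 0 < m / 8 := by positivity
  have hS8 : LocStencil S Cs (m / 8) := locStencil_mono hS hCs (by linarith)
  have hM8 : VertexFamily M N CM (m / 8) := fun μ y => biLoc_mono (hM μ y) hCM (by linarith)
  have h4 := vertexFamily₂_resp hK2 hS8 hM8 hm8
  rw [show m / 8 / 2 = m / 16 by ring] at h4
  intro μ y ν y'
  have h := KernelWard.biLoc_add (KernelWard.biLoc_add (KernelWard.biLoc_add (h1 μ y ν y') (h2 μ y ν y')) (h3 μ y ν y'))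
    (h4 μ y ν y')
  unfold CW2
  rw [show m / 8 / 2 = m / 16 by ring]
  exact h

/-- [folklore] **THE `JetData.loc₂` SOCKET, PACKAGED**: for a packed kernel with SOME decay and tables with SOME positive rates, the
second-order family `W2OfK K N S M S₂ M₂` is a bi-localised vertex family at blocking `N` for some constant and rate (all rates matched by
monotonicity to their minimum). -/
theorem vertexFamily₂_W2OfK' {K : MKer (d + 1) (Fib d)} (hK : ∃ δ C : ℝ, 0 < δ ∧ 0 ≤ C ∧ Decays K C δ)
    {S : Fin (d + 1) → (Fin (d + 1) → ℤ) → MKer (d + 1) (Fib d)} {Cs δs : ℝ}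
    {M : Fin (d + 1) → (Fin (d + 1) → ℤ) → MKer (d + 1) (Fib d)} {CM δM : ℝ}
    {S₂ : Fin (d + 1) → (Fin (d + 1) → ℤ) → Fin (d + 1) → (Fin (d + 1) → ℤ) → MKer (d + 1) (Fib d)} {C₂ δ₂ : ℝ}
    {M₂ : Fin (d + 1) → (Fin (d + 1) → ℤ) → Fin (d + 1) → (Fin (d + 1) → ℤ) → MKer (d + 1) (Fib d)} {CM₂ δ₃ : ℝ}
    (hS : LocStencil S Cs δs) (hδs : 0 < δs) (hM : VertexFamily M N CM δM) (hδM : 0 < δM) (hS₂ : LocStencil₂ S₂ C₂ δ₂)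
    (hδ₂ : 0 < δ₂) (hM₂ : LocStencilFM N M₂ CM₂ δ₃) (hδ₃ : 0 < δ₃) :
    ∃ Cw δw : ℝ, 0 < δw ∧ VertexFamily₂ (W2OfK K N S M S₂ M₂) N Cw δw := by
  obtain ⟨δK, C, hδK, hC, hKd⟩ := hK
  set m : ℝ := min (min (min (min δK δs) δM) δ₂) δ₃ with hm_def
  have hm : 0 < m := lt_min (lt_min (lt_min (lt_min hδK hδs) hδM) hδ₂) hδ₃
  have hm3 : m ≤ δ₃ := min_le_right _ _
  have hm2 : m ≤ δ₂ := (min_le_left _ _).trans (min_le_right _ _)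
  have hmM : m ≤ δM := (min_le_left _ _).trans ((min_le_left _ _).trans (min_le_right _ _))
  have hms : m ≤ δs := (min_le_left _ _).trans ((min_le_left _ _).trans ((min_le_left _ _).trans (min_le_right _ _)))
  have hmK : m ≤ δK := (min_le_left _ _).trans ((min_le_left _ _).trans ((min_le_left _ _).trans (min_le_left _ _)))
  have hCs : 0 ≤ Cs := (hS 0 0).nonneg (Sum.inl 0)
  have hCM : 0 ≤ CM := (hM 0 0).nonneg (Sum.inl 0)
  have hK' : Decays K C m := decays_mono hKd hC le_rfl hmK
  have hS' : LocStencil S Cs m := locStencil_mono hS hCs hms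
  have hM' : VertexFamily M N CM m := fun μ y => biLoc_mono (hM μ y) hCM hmM
  have hS₂' : LocStencil₂ S₂ C₂ m := hS₂.mono hm2
  have hM₂' : LocStencilFM N M₂ CM₂ m := hM₂.mono hm3
  exact ⟨_, _, by positivity, vertexFamily₂_W2OfK hK' hC hm hS' hM' hS₂' hM₂'⟩

end LocSecond

/-! ## §5 (v1.1) Block-translation covariance of the carriers — the (Wt) socket of `W2OfK` -/

section Covariance

variable {N : ℕ}

/-- [folklore] Two-family index shift of a superposition (`OneStepResolventKernel.wsum_shift` with the shifted family allowed to be a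
different one): if `K (u + v) = shiftK (−v) (G u)` for all `u` then `wsum (w (· − v)) K = shiftK (−v) (wsum w G)`. -/
theorem wsum_shift₂ {D : ℕ} {F : Type*} (w : (Fin D → ℤ) → ℝ) {K G : (Fin D → ℤ) → MKer D F} (v : Fin D → ℤ)
    (hK : ∀ u, K (u + v) = shiftK (-v) (G u)) : wsum (fun u => w (u - v)) K = shiftK (-v) (wsum w G) := by
  funext x z a b
  simp only [wsum, shiftK]
  rw [← tsum_shift (fun u => w (u - v) * K u x z a b) v]
  refine tsum_congr (fun u => ?_)
  rw [add_sub_cancel_right, hK u]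
  rfl

/-- [folklore] Two-family coarse index shift of a coarse superposition (`InterLevelTransport.cwsum_translate` with the shifted
family allowed to be a different one). -/
theorem cwsum_translate₂ [NeZero N] (w : (Fin (d + 1) → ℤ) → ℝ) {Q R : (Fin (d + 1) → ℤ) → MKer (d + 1) (Fib d)}
    (t : Fin (d + 1) → ℤ) (hQ : ∀ y, Q (y + t) = shiftK (-((N : ℤ) • t)) (R y)) :
    cwsum N (fun y => w (y - t)) Q = shiftK (-((N : ℤ) • t)) (cwsum N w R) := by
  unfold cwsum
  have hw' : onLat N (fun y => w (y - t)) = fun v => onLat N w (v - (N : ℤ) • t) := by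
    funext v
    simp only [onLat]
    have hp : Torus.proj N (v - (N : ℤ) • t) = Torus.proj N v := by
      rw [sub_eq_add_neg, ← smul_neg, proj_add_zsmul]
    have hq : quo N (v - (N : ℤ) • t) = quo N v - t := by
      rw [sub_eq_add_neg, ← smul_neg, quo_add_zsmul, ← sub_eq_add_neg]
    rw [hp, hq]
  rw [hw']
  refine wsum_shift₂ (onLat N w) ((N : ℤ) • t) (fun v => ?_)
  simp only [onLat]
  have hp : Torus.proj N (v + (N : ℤ) • t) = Torus.proj N v := proj_add_zsmul _ _
  have hq : quo N (v + (N : ℤ) • t) = quo N v + t := quo_add_zsmul _ _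
  rw [hp, hq]
  by_cases hv : Torus.proj N v = 0
  · simp only [hv, if_true, hQ]
  · simp only [hv, if_false]
    rfl

/-- [folklore] The field columns of a SHIFTED kernel at a shifted coarse bond are the re-indexed columns (no invariance needed). -/
theorem colH_shiftK (K : MKer (d + 1) (Fib d)) (N : ℕ) (μ : Fin (d + 1)) (y t : Fin (d + 1) → ℤ) (κ : Fin (d + 1))
    (u : Fin (d + 1) → ℤ) : colH (shiftK (-((N : ℤ) • t)) K) N μ (y + t) κ u = colH K N μ y κ (u - (N : ℤ) • t) := by
  simp only [colH, shiftK, smul_add, sub_eq_add_neg]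
  congr 1
  abel

/-- [folklore] The multiplier columns of a SHIFTED kernel at a shifted coarse bond are the re-indexed columns. -/
theorem colM_shiftK (K : MKer (d + 1) (Fib d)) (N : ℕ) (μ : Fin (d + 1)) (y t : Fin (d + 1) → ℤ) (ρ : Fin (d + 1))
    (w : Fin (d + 1) → ℤ) : colM (shiftK (-((N : ℤ) • t)) K) N μ (y + t) ρ w = colM K N μ y ρ (w - t) := by
  simp only [colM, shiftK, smul_add, sub_eq_add_neg, smul_neg]
  congr 1
  abel

/-- [folklore] **TWO-FAMILY COVARIANCE OF THE FIELD-COLUMN VERTEX THROUGH A SHIFTED KERNEL**: if `F κ (u + N•t) = shiftK (−N•t) (G κ u)`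
then `vertexOfK (shiftK (−N•t) K₂) N F μ (y + t) = shiftK (−N•t) (vertexOfK K₂ N G μ y)`. -/
theorem vertexOfK_shiftK_translate₂ (K₂ : MKer (d + 1) (Fib d)) {F G : Fin (d + 1) → (Fin (d + 1) → ℤ) → MKer (d + 1) (Fib d)}
    {t : Fin (d + 1) → ℤ} (hFG : ∀ (κ : Fin (d + 1)) (u : Fin (d + 1) → ℤ), F κ (u + (N : ℤ) • t) = shiftK (-((N : ℤ) • t)) (G κ u))
    (μ : Fin (d + 1)) (y : Fin (d + 1) → ℤ) :
    vertexOfK (shiftK (-((N : ℤ) • t)) K₂) N F μ (y + t) = shiftK (-((N : ℤ) • t)) (vertexOfK K₂ N G μ y) := by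
  funext x z a b
  simp only [vertexOfK]
  have h : ∀ κ : Fin (d + 1), wsum (colH (shiftK (-((N : ℤ) • t)) K₂) N μ (y + t) κ) (F κ)
      = shiftK (-((N : ℤ) • t)) (wsum (colH K₂ N μ y κ) (G κ)) := by
    intro κ
    have hw : colH (shiftK (-((N : ℤ) • t)) K₂) N μ (y + t) κ = fun u => colH K₂ N μ y κ (u - (N : ℤ) • t) :=
      funext (colH_shiftK K₂ N μ y t κ)
    rw [hw]
    exact wsum_shift₂ (colH K₂ N μ y κ) ((N : ℤ) • t) (fun u => hFG κ u)
  simp only [h, shiftK, vertexOfK]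

/-- [folklore] **TWO-FAMILY COVARIANCE OF THE MULTIPLIER-COLUMN VERTEX THROUGH A SHIFTED KERNEL**: if `F ρ (w + t) = shiftK (−N•t) (G ρ w)`
then `vertexOfM (shiftK (−N•t) K₂) N F μ (y + t) = shiftK (−N•t) (vertexOfM K₂ N G μ y)`. -/
theorem vertexOfM_shiftK_translate₂ [NeZero N] (K₂ : MKer (d + 1) (Fib d))
    {F G : Fin (d + 1) → (Fin (d + 1) → ℤ) → MKer (d + 1) (Fib d)} {t : Fin (d + 1) → ℤ}
    (hFG : ∀ (ρ : Fin (d + 1)) (w : Fin (d + 1) → ℤ), F ρ (w + t) = shiftK (-((N : ℤ) • t)) (G ρ w))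
    (μ : Fin (d + 1)) (y : Fin (d + 1) → ℤ) :
    vertexOfM (shiftK (-((N : ℤ) • t)) K₂) N F μ (y + t) = shiftK (-((N : ℤ) • t)) (vertexOfM K₂ N G μ y) := by
  funext x z a b
  simp only [vertexOfM]
  have h : ∀ ρ : Fin (d + 1), cwsum N (colM (shiftK (-((N : ℤ) • t)) K₂) N μ (y + t) ρ) (F ρ)
      = shiftK (-((N : ℤ) • t)) (cwsum N (colM K₂ N μ y ρ) (G ρ)) := by
    intro ρ
    have hw : colM (shiftK (-((N : ℤ) • t)) K₂) N μ (y + t) ρ = fun w => colM K₂ N μ y ρ (w - t) :=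
      funext (colM_shiftK K₂ N μ y t ρ)
    rw [hw]
    exact cwsum_translate₂ (colM K₂ N μ y ρ) t (fun w => hFG ρ w)
  simp only [h, shiftK, vertexOfM]

/-- [folklore] **COVARIANCE OF `dM` THROUGH A SHIFTED KERNEL** for block-covariant first tables. -/
theorem dM_shiftK_translate [NeZero N] (K₂ : MKer (d + 1) (Fib d))
    {S : Fin (d + 1) → (Fin (d + 1) → ℤ) → MKer (d + 1) (Fib d)} {M : Fin (d + 1) → (Fin (d + 1) → ℤ) → MKer (d + 1) (Fib d)}
    (hS : ∀ (κ : Fin (d + 1)) (u t : Fin (d + 1) → ℤ), S κ (u + (N : ℤ) • t) = shiftK (-((N : ℤ) • t)) (S κ u))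
    (hM : ∀ (ρ : Fin (d + 1)) (w t : Fin (d + 1) → ℤ), M ρ (w + t) = shiftK (-((N : ℤ) • t)) (M ρ w))
    (μ : Fin (d + 1)) (y t : Fin (d + 1) → ℤ) :
    dM (shiftK (-((N : ℤ) • t)) K₂) N S M μ (y + t) = shiftK (-((N : ℤ) • t)) (dM K₂ N S M μ y) := by
  funext x z a b
  show dM _ N S M μ (y + t) x z a b = dM K₂ N S M μ y (x + -((N : ℤ) • t)) (z + -((N : ℤ) • t)) a b
  rw [dM_apply, dM_apply, vertexOfK_shiftK_translate₂ K₂ (fun κ u => hS κ u t) μ y,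
    vertexOfM_shiftK_translate₂ K₂ (fun ρ w => hM ρ w t) μ y]
  rfl

/-- [folklore] **COVARIANCE OF `dM`** for a block-covariant kernel and block-covariant first tables. -/
theorem dM_translate [NeZero N] {K : MKer (d + 1) (Fib d)} (hKs : ∀ t, shiftK (-((N : ℤ) • t)) K = K)
    {S : Fin (d + 1) → (Fin (d + 1) → ℤ) → MKer (d + 1) (Fib d)} {M : Fin (d + 1) → (Fin (d + 1) → ℤ) → MKer (d + 1) (Fib d)}
    (hS : ∀ (κ : Fin (d + 1)) (u t : Fin (d + 1) → ℤ), S κ (u + (N : ℤ) • t) = shiftK (-((N : ℤ) • t)) (S κ u))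
    (hM : ∀ (ρ : Fin (d + 1)) (w t : Fin (d + 1) → ℤ), M ρ (w + t) = shiftK (-((N : ℤ) • t)) (M ρ w))
    (μ : Fin (d + 1)) (y t : Fin (d + 1) → ℤ) : dM K N S M μ (y + t) = shiftK (-((N : ℤ) • t)) (dM K N S M μ y) := by
  have h := dM_shiftK_translate K hS hM μ y t
  rwa [hKs t] at h

/-- [folklore] **COVARIANCE OF THE DERIVATIVE OF THE INVERSE** `K2OfK` (block-covariant `K`, block-covariant first tables). -/
theorem K2OfK_translate [NeZero N] {K : MKer (d + 1) (Fib d)} (hKs : ∀ t, shiftK (-((N : ℤ) • t)) K = K)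
    {S : Fin (d + 1) → (Fin (d + 1) → ℤ) → MKer (d + 1) (Fib d)} {M : Fin (d + 1) → (Fin (d + 1) → ℤ) → MKer (d + 1) (Fib d)}
    (hS : ∀ (κ : Fin (d + 1)) (u t : Fin (d + 1) → ℤ), S κ (u + (N : ℤ) • t) = shiftK (-((N : ℤ) • t)) (S κ u))
    (hM : ∀ (ρ : Fin (d + 1)) (w t : Fin (d + 1) → ℤ), M ρ (w + t) = shiftK (-((N : ℤ) • t)) (M ρ w))
    (ν : Fin (d + 1)) (y' t : Fin (d + 1) → ℤ) :
    K2OfK K N S M ν (y' + t) = shiftK (-((N : ℤ) • t)) (K2OfK K N S M ν y') := by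
  have hV := dM_translate hKs hS hM ν y' t
  have hc : comp (comp K (shiftK (-((N : ℤ) • t)) (dM K N S M ν y'))) K
      = shiftK (-((N : ℤ) • t)) (comp (comp K (dM K N S M ν y')) K) := by
    conv_rhs => rw [← comp_shiftK, ← comp_shiftK, hKs t]
  funext x z a b
  simp only [K2OfK, shiftK]
  rw [hV, hc]
  rfl

/-- [folklore] **COVARIANCE OF THE BI-VERTEX** for a block-covariant kernel and a JOINTLY block-covariant bi-stencil family
`S₂ κ (u + N•t) κ′ (u′ + N•t) = shiftK (−N•t) (S₂ κ u κ′ u′)` (the shape of an3's `WilsonBiStencil.wilsonW₂_translate`). -/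
theorem vertex2OfK_translate {K : MKer (d + 1) (Fib d)} (hKs : ∀ t, shiftK (-((N : ℤ) • t)) K = K)
    {S₂ : Fin (d + 1) → (Fin (d + 1) → ℤ) → Fin (d + 1) → (Fin (d + 1) → ℤ) → MKer (d + 1) (Fib d)}
    (hS₂ : ∀ (κ : Fin (d + 1)) (u : Fin (d + 1) → ℤ) (κ' : Fin (d + 1)) (u' t : Fin (d + 1) → ℤ),
      S₂ κ (u + (N : ℤ) • t) κ' (u' + (N : ℤ) • t) = shiftK (-((N : ℤ) • t)) (S₂ κ u κ' u'))
    (μ : Fin (d + 1)) (y : Fin (d + 1) → ℤ) (ν : Fin (d + 1)) (y' t : Fin (d + 1) → ℤ) :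
    vertex2OfK K N S₂ μ (y + t) ν (y' + t) = shiftK (-((N : ℤ) • t)) (vertex2OfK K N S₂ μ y ν y') := by
  have hin : ∀ (κ : Fin (d + 1)) (u : Fin (d + 1) → ℤ),
      vertexOfK K N (S₂ κ (u + (N : ℤ) • t)) ν (y' + t) = shiftK (-((N : ℤ) • t)) (vertexOfK K N (S₂ κ u) ν y') := by
    intro κ u
    have h := vertexOfK_shiftK_translate₂ (N := N) K (F := S₂ κ (u + (N : ℤ) • t)) (G := S₂ κ u) (t := t)
      (fun κ' u' => hS₂ κ u κ' u' t) ν y'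
    rwa [hKs t] at h
  have h := vertexOfK_shiftK_translate₂ (N := N) K (F := fun κ u => vertexOfK K N (S₂ κ u) ν (y' + t))
    (G := fun κ u => vertexOfK K N (S₂ κ u) ν y') (t := t) hin μ y
  rw [hKs t] at h
  exact h

/-- [folklore] **COVARIANCE OF THE MIXED BI-VERTEX** for a block-covariant kernel and a JOINTLY block-covariant field–multiplier table
`M₂ κ (u + N•t) ρ (w + t) = shiftK (−N•t) (M₂ κ u ρ w)`. -/
theorem mixOfK_translate [NeZero N] {K : MKer (d + 1) (Fib d)} (hKs : ∀ t, shiftK (-((N : ℤ) • t)) K = K)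
    {M₂ : Fin (d + 1) → (Fin (d + 1) → ℤ) → Fin (d + 1) → (Fin (d + 1) → ℤ) → MKer (d + 1) (Fib d)}
    (hM₂ : ∀ (κ : Fin (d + 1)) (u : Fin (d + 1) → ℤ) (ρ : Fin (d + 1)) (w t : Fin (d + 1) → ℤ),
      M₂ κ (u + (N : ℤ) • t) ρ (w + t) = shiftK (-((N : ℤ) • t)) (M₂ κ u ρ w))
    (μ : Fin (d + 1)) (y : Fin (d + 1) → ℤ) (ν : Fin (d + 1)) (y' t : Fin (d + 1) → ℤ) :
    mixOfK K N M₂ μ (y + t) ν (y' + t) = shiftK (-((N : ℤ) • t)) (mixOfK K N M₂ μ y ν y') := by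
  have hin : ∀ (κ : Fin (d + 1)) (u : Fin (d + 1) → ℤ),
      vertexOfM K N (M₂ κ (u + (N : ℤ) • t)) ν (y' + t) = shiftK (-((N : ℤ) • t)) (vertexOfM K N (M₂ κ u) ν y') := by
    intro κ u
    have h := vertexOfM_shiftK_translate₂ (N := N) K (F := M₂ κ (u + (N : ℤ) • t)) (G := M₂ κ u) (t := t)
      (fun ρ w => hM₂ κ u ρ w t) ν y'
    rwa [hKs t] at h
  have h := vertexOfK_shiftK_translate₂ (N := N) K (F := fun κ u => vertexOfM K N (M₂ κ u) ν (y' + t))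
    (G := fun κ u => vertexOfM K N (M₂ κ u) ν y') (t := t) hin μ y
  rw [hKs t] at h
  exact h

/-- [folklore] **(Wt) FOR THE SECOND-ORDER CARRIER**: for a block-covariant packed kernel `K` (`shiftK (−N•t) K = K`, e.g. an4's
`shiftK_KInvStep`), block-covariant first tables `S`, `M` and jointly block-covariant second tables `S₂`, `M₂`,
`W2OfK K N S M S₂ M₂ μ (y + t) ν (y′ + t) = shiftK (−N•t) (W2OfK K N S M S₂ M₂ μ y ν y′)` — exactly the `hWt` byte shape of
`BalabanStepJetsSucc.JsBalOf_W_translate` / an5's `ResolventReflection` END theorem. -/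
theorem W2OfK_translate [NeZero N] {K : MKer (d + 1) (Fib d)} (hKs : ∀ t, shiftK (-((N : ℤ) • t)) K = K)
    {S : Fin (d + 1) → (Fin (d + 1) → ℤ) → MKer (d + 1) (Fib d)} {M : Fin (d + 1) → (Fin (d + 1) → ℤ) → MKer (d + 1) (Fib d)}
    {S₂ : Fin (d + 1) → (Fin (d + 1) → ℤ) → Fin (d + 1) → (Fin (d + 1) → ℤ) → MKer (d + 1) (Fib d)}
    {M₂ : Fin (d + 1) → (Fin (d + 1) → ℤ) → Fin (d + 1) → (Fin (d + 1) → ℤ) → MKer (d + 1) (Fib d)}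
    (hS : ∀ (κ : Fin (d + 1)) (u t : Fin (d + 1) → ℤ), S κ (u + (N : ℤ) • t) = shiftK (-((N : ℤ) • t)) (S κ u))
    (hM : ∀ (ρ : Fin (d + 1)) (w t : Fin (d + 1) → ℤ), M ρ (w + t) = shiftK (-((N : ℤ) • t)) (M ρ w))
    (hS₂ : ∀ (κ : Fin (d + 1)) (u : Fin (d + 1) → ℤ) (κ' : Fin (d + 1)) (u' t : Fin (d + 1) → ℤ),
      S₂ κ (u + (N : ℤ) • t) κ' (u' + (N : ℤ) • t) = shiftK (-((N : ℤ) • t)) (S₂ κ u κ' u'))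
    (hM₂ : ∀ (κ : Fin (d + 1)) (u : Fin (d + 1) → ℤ) (ρ : Fin (d + 1)) (w t : Fin (d + 1) → ℤ),
      M₂ κ (u + (N : ℤ) • t) ρ (w + t) = shiftK (-((N : ℤ) • t)) (M₂ κ u ρ w))
    (μ : Fin (d + 1)) (y : Fin (d + 1) → ℤ) (ν : Fin (d + 1)) (y' t : Fin (d + 1) → ℤ) :
    W2OfK K N S M S₂ M₂ μ (y + t) ν (y' + t) = shiftK (-((N : ℤ) • t)) (W2OfK K N S M S₂ M₂ μ y ν y') := by
  have h1 := vertex2OfK_translate hKs hS₂ μ y ν y' t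
  have h2 := mixOfK_translate hKs hM₂ μ y ν y' t
  have h3 := mixOfK_translate hKs hM₂ ν y' μ y t
  have h4 : dM (K2OfK K N S M ν (y' + t)) N S M μ (y + t) = shiftK (-((N : ℤ) • t)) (dM (K2OfK K N S M ν y') N S M μ y) := by
    rw [K2OfK_translate hKs hS hM ν y' t]
    exact dM_shiftK_translate _ hS hM μ y t
  funext x z a b
  simp only [W2OfK_apply, Pi.add_apply, shiftK]
  rw [h1, h2, h3, h4]
  rfl

end Covariance

/-! ## §6 (v1.1) The swap-symmetrised carrier `W2SymOfK` -/

section Symmetric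

variable {N : ℕ} [NeZero N]

/-- [folklore] **THE SWAP-SYMMETRISED SECOND-ORDER CARRIER** `W2Sym μ y ν y′ := ½•(W2OfK μ y ν y′ + W2OfK ν y′ μ y)`.  For tables that
ARE the partial-derivative tables of one bordered operator (third partials symmetric) `W2OfK` is already symmetric under the swap of
the two coarse bonds and `W2Sym = W2OfK` (`W2SymOfK_eq_of_swap`); for GENERIC tables the symmetrised carrier is the object with the
symmetry the second background derivative has. -/
def W2SymOfK (K : MKer (d + 1) (Fib d)) (N : ℕ) (S : Fin (d + 1) → (Fin (d + 1) → ℤ) → MKer (d + 1) (Fib d))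
    (M : Fin (d + 1) → (Fin (d + 1) → ℤ) → MKer (d + 1) (Fib d))
    (S₂ : Fin (d + 1) → (Fin (d + 1) → ℤ) → Fin (d + 1) → (Fin (d + 1) → ℤ) → MKer (d + 1) (Fib d))
    (M₂ : Fin (d + 1) → (Fin (d + 1) → ℤ) → Fin (d + 1) → (Fin (d + 1) → ℤ) → MKer (d + 1) (Fib d))
    (μ : Fin (d + 1)) (y : Fin (d + 1) → ℤ) (ν : Fin (d + 1)) (y' : Fin (d + 1) → ℤ) : MKer (d + 1) (Fib d) :=
  (1 / 2 : ℝ) • (W2OfK K N S M S₂ M₂ μ y ν y' + W2OfK K N S M S₂ M₂ ν y' μ y)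

/-- [folklore] `W2SymOfK` is symmetric under the swap of the two coarse bonds, by construction. -/
theorem W2SymOfK_swap (K : MKer (d + 1) (Fib d)) (N : ℕ) (S : Fin (d + 1) → (Fin (d + 1) → ℤ) → MKer (d + 1) (Fib d))
    (M : Fin (d + 1) → (Fin (d + 1) → ℤ) → MKer (d + 1) (Fib d))
    (S₂ : Fin (d + 1) → (Fin (d + 1) → ℤ) → Fin (d + 1) → (Fin (d + 1) → ℤ) → MKer (d + 1) (Fib d))
    (M₂ : Fin (d + 1) → (Fin (d + 1) → ℤ) → Fin (d + 1) → (Fin (d + 1) → ℤ) → MKer (d + 1) (Fib d))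
    (μ : Fin (d + 1)) (y : Fin (d + 1) → ℤ) (ν : Fin (d + 1)) (y' : Fin (d + 1) → ℤ) :
    W2SymOfK K N S M S₂ M₂ ν y' μ y = W2SymOfK K N S M S₂ M₂ μ y ν y' := by
  unfold W2SymOfK
  rw [add_comm (W2OfK K N S M S₂ M₂ ν y' μ y)]

/-- [folklore] For swap-symmetric `W2OfK` (Lagrangian tables) the symmetrised carrier is `W2OfK` itself. -/
theorem W2SymOfK_eq_of_swap {K : MKer (d + 1) (Fib d)} {N : ℕ} {S : Fin (d + 1) → (Fin (d + 1) → ℤ) → MKer (d + 1) (Fib d)}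
    {M : Fin (d + 1) → (Fin (d + 1) → ℤ) → MKer (d + 1) (Fib d)}
    {S₂ : Fin (d + 1) → (Fin (d + 1) → ℤ) → Fin (d + 1) → (Fin (d + 1) → ℤ) → MKer (d + 1) (Fib d)}
    {M₂ : Fin (d + 1) → (Fin (d + 1) → ℤ) → Fin (d + 1) → (Fin (d + 1) → ℤ) → MKer (d + 1) (Fib d)}
    (h : ∀ μ y ν y', W2OfK K N S M S₂ M₂ ν y' μ y = W2OfK K N S M S₂ M₂ μ y ν y')
    (μ : Fin (d + 1)) (y : Fin (d + 1) → ℤ) (ν : Fin (d + 1)) (y' : Fin (d + 1) → ℤ) :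
    W2SymOfK K N S M S₂ M₂ μ y ν y' = W2OfK K N S M S₂ M₂ μ y ν y' := by
  unfold W2SymOfK
  rw [h μ y ν y', ← two_smul ℝ (W2OfK K N S M S₂ M₂ μ y ν y'), smul_smul]
  norm_num

/-- [folklore] A scalar multiple of a bi-localised kernel. -/
theorem biLoc_smul {D : ℕ} {F : Type*} {K : MKer D F} {p q : Fin D → ℤ} {C δ : ℝ} (c : ℝ) (h : BiLoc K p q C δ) :
    BiLoc (c • K) p q (|c| * C) δ := by
  intro x z a b
  rw [Pi.smul_apply, Pi.smul_apply, Pi.smul_apply, Pi.smul_apply, smul_eq_mul, abs_mul, mul_assoc]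
  exact mul_le_mul_of_nonneg_left (h x z a b) (abs_nonneg c)

omit [NeZero N] in
/-- [folklore] **LOCALISATION OF THE EXCHANGED BI-VERTEX** `(μ, y, ν, y′) ↦ vertex2OfK K N S₂ ν y′ μ y` in the index order of `W`
(`biLoc_vertexOfK_slice` + `biLoc_wsum_self_far` + `biLoc_recenter_left`, as for `vertexFamily₂_mixOfK_swap`). -/
theorem vertexFamily₂_vertex2OfK_swap {K : MKer (d + 1) (Fib d)} {C m : ℝ} (hK : Decays K C m) (hC : 0 ≤ C)
    {S₂ : Fin (d + 1) → (Fin (d + 1) → ℤ) → Fin (d + 1) → (Fin (d + 1) → ℤ) → MKer (d + 1) (Fib d)} {C₂ : ℝ}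
    (hS₂ : LocStencil₂ S₂ C₂ m) (hm : 0 < m) :
    VertexFamily₂ (fun μ y ν y' => vertex2OfK K N S₂ ν y' μ y) N (cBi d C C₂ m) (m / 8) := by
  intro μ y ν y'
  have hC₂ := hS₂.nonneg
  have hZ2 := Zl_nonneg (D := d + 1) (half_pos hm)
  have hK₁ : 0 ≤ (d + 1 : ℕ) * (C * C₂ * Zl (d + 1) (m / 2)) := by positivity
  have hin : ∀ (κ : Fin (d + 1)) (u : Fin (d + 1) → ℤ), BiLoc (vertexOfK K N (S₂ κ u) μ y) u u
      ((d + 1 : ℕ) * (C * C₂ * Zl (d + 1) (m / 2)) * Real.exp (-(m / 2) * l1 (u - (N : ℤ) • y))) (m / 2) := by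
    intro κ u
    have h := biLoc_vertexOfK_slice (N := N) hK hC hS₂ hm κ u μ y
    rw [← mul_assoc] at h
    exact biLoc_mono h (by positivity) (by linarith)
  have hw : ∀ (κ : Fin (d + 1)) (u : Fin (d + 1) → ℤ),
      |colH K N ν y' κ u| ≤ C * Real.exp (-(m / 2) * l1 (u - (N : ℤ) • y')) :=
    fun κ u => bound_mono (abs_colH_le (N := N) hK ν y' κ u) hC le_rfl (by linarith) (l1_nonneg _)
  have hterm : ∀ κ : Fin (d + 1), BiLoc (wsum (colH K N ν y' κ) (fun u => vertexOfK K N (S₂ κ u) μ y))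
      ((N : ℤ) • y') ((N : ℤ) • y') (C * ((d + 1 : ℕ) * (C * C₂ * Zl (d + 1) (m / 2))) * Zl (d + 1) (m / 2 / 4)
        * Real.exp (-(m / 2 / 4) * l1 ((N : ℤ) • y' - (N : ℤ) • y))) (m / 2 / 4) :=
    fun κ => biLoc_wsum_self_far (hw κ) (hin κ) (half_pos hm) hC hK₁
  have hsum := OneStepResolventKernel.biLoc_finset_sum (Finset.univ : Finset (Fin (d + 1))) (fun κ _ => hterm κ)
  simp only [Finset.sum_const, Finset.card_univ, Fintype.card_fin, nsmul_eq_mul] at hsum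
  rw [show m / 2 / 4 = m / 8 by ring, l1_sub_symm ((N : ℤ) • y') ((N : ℤ) • y)] at hsum
  have e : (d + 1 : ℕ) * (C * ((d + 1 : ℕ) * (C * C₂ * Zl (d + 1) (m / 2))) * Zl (d + 1) (m / 8)
      * Real.exp (-(m / 8) * l1 ((N : ℤ) • y - (N : ℤ) • y')))
      = cBi d C C₂ m * Real.exp (-(m / 8) * l1 ((N : ℤ) • y - (N : ℤ) • y')) := by unfold cBi; ring
  rw [e] at hsum
  exact biLoc_recenter_left hsum (cBi_nonneg hC hC₂ hm) (by positivity) le_rfl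

/-- [folklore] **LOCALISATION OF THE EXCHANGED SECOND-RESPONSE PIECE** `(μ, y, ν, y′) ↦ dM (K2 μ y) N S M ν y′`: bi-localised at `N•y`
with a constant decaying in `|N•y′ − N•y|`; the SECOND leg is re-centred to `N•y′` (`biLoc_recenter_right`). -/
theorem vertexFamily₂_resp_swap {K2 : Fin (d + 1) → (Fin (d + 1) → ℤ) → MKer (d + 1) (Fib d)} {C₂ m : ℝ} (hK2 : VertexFamily K2 N C₂ m)
    {S : Fin (d + 1) → (Fin (d + 1) → ℤ) → MKer (d + 1) (Fib d)} {Cs : ℝ}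
    {M : Fin (d + 1) → (Fin (d + 1) → ℤ) → MKer (d + 1) (Fib d)} {CM : ℝ} (hS : LocStencil S Cs m) (hM : VertexFamily M N CM m)
    (hm : 0 < m) :
    VertexFamily₂ (fun μ y ν y' => dM (K2 μ y) N S M ν y') N
      ((d + 1 : ℕ) * (C₂ * Cs * Zl (d + 1) (m / 2)) + (d + 1 : ℕ) * (C₂ * CM * Zl (d + 1) (m / 2))) (m / 2) := by
  intro μ y ν y'
  have h := KernelWard.biLoc_add (biLoc_vertexOfK_of_biLoc (N := N) (hK2 μ y) hS hm ν y')
    (biLoc_vertexOfM_of_biLoc (N := N) (hK2 μ y) hM hm ν y')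
  have e : (d + 1 : ℕ) * (C₂ * Real.exp (-m * l1 ((N : ℤ) • y' - (N : ℤ) • y)) * Cs * Zl (d + 1) (m / 2))
      + (d + 1 : ℕ) * (C₂ * Real.exp (-m * l1 ((N : ℤ) • y' - (N : ℤ) • y)) * CM * Zl (d + 1) (m / 2))
      = ((d + 1 : ℕ) * (C₂ * Cs * Zl (d + 1) (m / 2)) + (d + 1 : ℕ) * (C₂ * CM * Zl (d + 1) (m / 2)))
        * Real.exp (-m * l1 ((N : ℤ) • y' - (N : ℤ) • y)) := by ring
  rw [e] at h
  have hC₂ : 0 ≤ C₂ := (hK2 0 0).nonneg (Sum.inl 0)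
  have hCs : 0 ≤ Cs := (hS 0 0).nonneg (Sum.inl 0)
  have hCM : 0 ≤ CM := (hM 0 0).nonneg (Sum.inl 0)
  have hZ := Zl_nonneg (D := d + 1) (half_pos hm)
  exact biLoc_recenter_right h (by positivity) (half_pos hm).le (by linarith)

/-- [folklore] **LOCALISATION OF THE EXCHANGED CARRIER** `(μ, y, ν, y′) ↦ W2OfK … ν y′ μ y` in the index order of `W`: same constant
`CW2` and rate `m/16` as `vertexFamily₂_W2OfK` (the four exchanged pieces: `vertexFamily₂_vertex2OfK_swap`, `vertexFamily₂_mixOfK_swap`,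
`vertexFamily₂_mixOfK`, `vertexFamily₂_resp_swap`). -/
theorem vertexFamily₂_W2OfK_swap {K : MKer (d + 1) (Fib d)} {C m : ℝ} (hK : Decays K C m) (hC : 0 ≤ C) (hm : 0 < m)
    {S : Fin (d + 1) → (Fin (d + 1) → ℤ) → MKer (d + 1) (Fib d)} {Cs : ℝ}
    {M : Fin (d + 1) → (Fin (d + 1) → ℤ) → MKer (d + 1) (Fib d)} {CM : ℝ}
    {S₂ : Fin (d + 1) → (Fin (d + 1) → ℤ) → Fin (d + 1) → (Fin (d + 1) → ℤ) → MKer (d + 1) (Fib d)} {C₂ : ℝ}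
    {M₂ : Fin (d + 1) → (Fin (d + 1) → ℤ) → Fin (d + 1) → (Fin (d + 1) → ℤ) → MKer (d + 1) (Fib d)} {CM₂ : ℝ}
    (hS : LocStencil S Cs m) (hM : VertexFamily M N CM m) (hS₂ : LocStencil₂ S₂ C₂ m) (hM₂ : LocStencilFM N M₂ CM₂ m) :
    VertexFamily₂ (fun μ y ν y' => W2OfK K N S M S₂ M₂ ν y' μ y) N (CW2 d C Cs CM C₂ CM₂ m) (m / 16) := by
  have hCs : 0 ≤ Cs := (hS 0 0).nonneg (Sum.inl 0)
  have hCM : 0 ≤ CM := (hM 0 0).nonneg (Sum.inl 0)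
  have hC₂ := hS₂.nonneg
  have hCM₂ := hM₂.nonneg
  have h16 : m / 16 ≤ m / 8 := by linarith
  have h1 : VertexFamily₂ (fun μ y ν y' => vertex2OfK K N S₂ ν y' μ y) N (cBi d C C₂ m) (m / 16) :=
    vertexFamily₂_mono (vertexFamily₂_vertex2OfK_swap (N := N) hK hC hS₂ hm) (cBi_nonneg hC hC₂ hm) h16
  have h2 : VertexFamily₂ (fun μ y ν y' => mixOfK K N M₂ ν y' μ y) N (cBi d C CM₂ m) (m / 16) :=
    vertexFamily₂_mono (vertexFamily₂_mixOfK_swap (N := N) hK hC hM₂ hm) (cBi_nonneg hC hCM₂ hm) h16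
  have h3 : VertexFamily₂ (mixOfK K N M₂) N (cBi d C CM₂ m) (m / 16) :=
    vertexFamily₂_mono (vertexFamily₂_mixOfK (N := N) hK hC hM₂ hm) (cBi_nonneg hC hCM₂ hm) h16
  have hK2 := vertexFamily_K2OfK (N := N) hK hC hm hS hM
  have hm8 : 0 < m / 8 := by positivity
  have hS8 : LocStencil S Cs (m / 8) := locStencil_mono hS hCs (by linarith)
  have hM8 : VertexFamily M N CM (m / 8) := fun μ y => biLoc_mono (hM μ y) hCM (by linarith)
  have h4 := vertexFamily₂_resp_swap hK2 hS8 hM8 hm8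
  rw [show m / 8 / 2 = m / 16 by ring] at h4
  intro μ y ν y'
  have h := KernelWard.biLoc_add (KernelWard.biLoc_add (KernelWard.biLoc_add (h1 μ y ν y') (h2 μ y ν y')) (h3 μ y ν y'))
    (h4 μ y ν y')
  unfold CW2
  rw [show m / 8 / 2 = m / 16 by ring]
  exact h

/-- [folklore] **THE SYMMETRISED CARRIER IS A BI-LOCALISED VERTEX FAMILY**, same constant `CW2` and rate `m/16`
(`vertexFamily₂_W2OfK` + `vertexFamily₂_W2OfK_swap`, `KernelWard.biLoc_add`, `biLoc_smul` with `|½|·(CW2 + CW2) = CW2`). -/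
theorem vertexFamily₂_W2SymOfK {K : MKer (d + 1) (Fib d)} {C m : ℝ} (hK : Decays K C m) (hC : 0 ≤ C) (hm : 0 < m)
    {S : Fin (d + 1) → (Fin (d + 1) → ℤ) → MKer (d + 1) (Fib d)} {Cs : ℝ}
    {M : Fin (d + 1) → (Fin (d + 1) → ℤ) → MKer (d + 1) (Fib d)} {CM : ℝ}
    {S₂ : Fin (d + 1) → (Fin (d + 1) → ℤ) → Fin (d + 1) → (Fin (d + 1) → ℤ) → MKer (d + 1) (Fib d)} {C₂ : ℝ}
    {M₂ : Fin (d + 1) → (Fin (d + 1) → ℤ) → Fin (d + 1) → (Fin (d + 1) → ℤ) → MKer (d + 1) (Fib d)} {CM₂ : ℝ}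
    (hS : LocStencil S Cs m) (hM : VertexFamily M N CM m) (hS₂ : LocStencil₂ S₂ C₂ m) (hM₂ : LocStencilFM N M₂ CM₂ m) :
    VertexFamily₂ (W2SymOfK K N S M S₂ M₂) N (CW2 d C Cs CM C₂ CM₂ m) (m / 16) := by
  intro μ y ν y'
  have h := biLoc_smul (1 / 2 : ℝ) (KernelWard.biLoc_add (vertexFamily₂_W2OfK hK hC hm hS hM hS₂ hM₂ μ y ν y')
    (vertexFamily₂_W2OfK_swap hK hC hm hS hM hS₂ hM₂ μ y ν y'))
  have e : |(1 / 2 : ℝ)| * (CW2 d C Cs CM C₂ CM₂ m + CW2 d C Cs CM C₂ CM₂ m) = CW2 d C Cs CM C₂ CM₂ m := by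
    rw [abs_of_pos (by norm_num : (0 : ℝ) < 1 / 2)]
    ring
  rw [e] at h
  exact h

/-- [folklore] **THE `JetData.loc₂` SOCKET FOR THE SYMMETRISED CARRIER, PACKAGED** (SOME decay of `K`, SOME positive table rates). -/
theorem vertexFamily₂_W2SymOfK' {K : MKer (d + 1) (Fib d)} (hK : ∃ δ C : ℝ, 0 < δ ∧ 0 ≤ C ∧ Decays K C δ)
    {S : Fin (d + 1) → (Fin (d + 1) → ℤ) → MKer (d + 1) (Fib d)} {Cs δs : ℝ}
    {M : Fin (d + 1) → (Fin (d + 1) → ℤ) → MKer (d + 1) (Fib d)} {CM δM : ℝ}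
    {S₂ : Fin (d + 1) → (Fin (d + 1) → ℤ) → Fin (d + 1) → (Fin (d + 1) → ℤ) → MKer (d + 1) (Fib d)} {C₂ δ₂ : ℝ}
    {M₂ : Fin (d + 1) → (Fin (d + 1) → ℤ) → Fin (d + 1) → (Fin (d + 1) → ℤ) → MKer (d + 1) (Fib d)} {CM₂ δ₃ : ℝ}
    (hS : LocStencil S Cs δs) (hδs : 0 < δs) (hM : VertexFamily M N CM δM) (hδM : 0 < δM) (hS₂ : LocStencil₂ S₂ C₂ δ₂)
    (hδ₂ : 0 < δ₂) (hM₂ : LocStencilFM N M₂ CM₂ δ₃) (hδ₃ : 0 < δ₃) :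
    ∃ Cw δw : ℝ, 0 < δw ∧ VertexFamily₂ (W2SymOfK K N S M S₂ M₂) N Cw δw := by
  obtain ⟨δK, C, hδK, hC, hKd⟩ := hK
  set m : ℝ := min (min (min (min δK δs) δM) δ₂) δ₃ with hm_def
  have hm : 0 < m := lt_min (lt_min (lt_min (lt_min hδK hδs) hδM) hδ₂) hδ₃
  have hm3 : m ≤ δ₃ := min_le_right _ _
  have hm2 : m ≤ δ₂ := (min_le_left _ _).trans (min_le_right _ _)
  have hmM : m ≤ δM := (min_le_left _ _).trans ((min_le_left _ _).trans (min_le_right _ _))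
  have hms : m ≤ δs := (min_le_left _ _).trans ((min_le_left _ _).trans ((min_le_left _ _).trans (min_le_right _ _)))
  have hmK : m ≤ δK := (min_le_left _ _).trans ((min_le_left _ _).trans ((min_le_left _ _).trans (min_le_left _ _)))
  have hCs : 0 ≤ Cs := (hS 0 0).nonneg (Sum.inl 0)
  have hCM : 0 ≤ CM := (hM 0 0).nonneg (Sum.inl 0)
  have hK' : Decays K C m := decays_mono hKd hC le_rfl hmK
  have hS' : LocStencil S Cs m := locStencil_mono hS hCs hms
  have hM' : VertexFamily M N CM m := fun μ y => biLoc_mono (hM μ y) hCM hmM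
  have hS₂' : LocStencil₂ S₂ C₂ m := hS₂.mono hm2
  have hM₂' : LocStencilFM N M₂ CM₂ m := hM₂.mono hm3
  exact ⟨_, _, by positivity, vertexFamily₂_W2SymOfK hK' hC hm hS' hM' hS₂' hM₂'⟩

/-- [folklore] **(Wt) FOR THE SYMMETRISED CARRIER** (from `W2OfK_translate` at both index orders). -/
theorem W2SymOfK_translate {K : MKer (d + 1) (Fib d)} (hKs : ∀ t, shiftK (-((N : ℤ) • t)) K = K)
    {S : Fin (d + 1) → (Fin (d + 1) → ℤ) → MKer (d + 1) (Fib d)} {M : Fin (d + 1) → (Fin (d + 1) → ℤ) → MKer (d + 1) (Fib d)}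
    {S₂ : Fin (d + 1) → (Fin (d + 1) → ℤ) → Fin (d + 1) → (Fin (d + 1) → ℤ) → MKer (d + 1) (Fib d)}
    {M₂ : Fin (d + 1) → (Fin (d + 1) → ℤ) → Fin (d + 1) → (Fin (d + 1) → ℤ) → MKer (d + 1) (Fib d)}
    (hS : ∀ (κ : Fin (d + 1)) (u t : Fin (d + 1) → ℤ), S κ (u + (N : ℤ) • t) = shiftK (-((N : ℤ) • t)) (S κ u))
    (hM : ∀ (ρ : Fin (d + 1)) (w t : Fin (d + 1) → ℤ), M ρ (w + t) = shiftK (-((N : ℤ) • t)) (M ρ w))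
    (hS₂ : ∀ (κ : Fin (d + 1)) (u : Fin (d + 1) → ℤ) (κ' : Fin (d + 1)) (u' t : Fin (d + 1) → ℤ),
      S₂ κ (u + (N : ℤ) • t) κ' (u' + (N : ℤ) • t) = shiftK (-((N : ℤ) • t)) (S₂ κ u κ' u'))
    (hM₂ : ∀ (κ : Fin (d + 1)) (u : Fin (d + 1) → ℤ) (ρ : Fin (d + 1)) (w t : Fin (d + 1) → ℤ),
      M₂ κ (u + (N : ℤ) • t) ρ (w + t) = shiftK (-((N : ℤ) • t)) (M₂ κ u ρ w))
    (μ : Fin (d + 1)) (y : Fin (d + 1) → ℤ) (ν : Fin (d + 1)) (y' t : Fin (d + 1) → ℤ) :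
    W2SymOfK K N S M S₂ M₂ μ (y + t) ν (y' + t) = shiftK (-((N : ℤ) • t)) (W2SymOfK K N S M S₂ M₂ μ y ν y') := by
  unfold W2SymOfK
  rw [W2OfK_translate hKs hS hM hS₂ hM₂ μ y ν y' t, W2OfK_translate hKs hS hM hS₂ hM₂ ν y' μ y t]
  funext x z a b
  simp only [Pi.smul_apply, Pi.add_apply, shiftK]

end Symmetric

end Literature.MathematicalPhysics.QuantumFieldTheory.Balaban1983to89.Beta.SecondOrderResponse

end
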